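import Literature.Probability.RandomPlanarGeometry.YangBaxterSAWHexDictionary
import HarnessLib

/-!
# The winding side of the `θ = π/3` dictionary: Duminil-Copin–Smirnov's encircling loop class is
Glazman–Manolescu's wound returning class

Topic `Literature/Probability/RandomPlanarGeometry`; companion of `YangBaxterSAWHexDictionary.lean` (the `θ = π/3`
dictionary: `Face.hv`, `YBWalk.hvWalk`, `triSet`, `isMidWalk_hvWalk_of_origin`, §15 the hole-root defect as the signed
weight of the ENCIRCLING loop-class honeycomb walks), of the lane's `HexSAWVertexRelationHoleRoot.lean` (`HV.loopWnd`:
the winding number of the loop of a loop-class walk about the root face `(1, 0)`, deciding whether its pair cancels in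
Duminil-Copin–Smirnov's vertex relation), of `YangBaxterSAWExcursionJordan.lean` (`ΩG.rayCountAt`, the number of
crossings of the lattice half-line behind a mid-edge by the excursion polygon of a walk of class `B2a`, and the parity
law `ΩG.AJ_root_ne_zero_iff_odd_rayCountAt`: wound ⟺ odd) and of `HexSAWWinding.lean` (`HV.wnd`, `HV.IsCyc`, `HV.Good`,
`good_or_good_reverse`).

What the sources print. H. Duminil-Copin, S. Smirnov, Ann. of Math. 175 (2012), proof of Lemma 1: the walks «visiting
all three mid-edges» of a vertex are grouped in pairs `γ₁, γ₂` differing by the orientation of a loop, whose windings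
differ by `±4π/3` — «In order to evaluate the winding of γ₁ between p and q above, we used the fact that a is on the
boundary and Ω is simply connected» (arXiv:1007.0575v2, p. 4): when the loop winds about the root the two windings differ
by `∓8π/3` instead and the pair does not cancel (the lane's `HexSAWVertexRelationHoleRoot.pair_sum_of_wnd_ne_zero`).
A. Glazman, I. Manolescu, arXiv:1708.00395v3, Lemma 2.1 (proof = A. Glazman, ECP 20 (2015), Lemma 3.1, pp. 6–7): the
walks of the returning class at a rhombus `r` (first crossing of `∂r`, one arc of `r`, an excursion, return to `∂r`) are
grouped with their reversed excursion; the group cancels unless the excursion winds about the root (the tree's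
`ΩG.G_add_G_rev_of_wound`, `UnwoundAt`). R. Courant, H. Robbins, *What is Mathematics?*, Ch. V Appendix §2: the even–odd
rule for polygons.

What is formalised here.

* §1 (namespace `…SAW.HV`) ★★ `Good.wnd_eq_zero_or_one`, `IsCyc.wnd_trichotomy`, `IsCyc.natAbs_wnd_le_one`,
  `IsCyc.wnd_ne_zero_iff_odd` — **A SIMPLE CYCLE OF THE HONEYCOMB LATTICE WINDS AT MOST ONCE ABOUT EVERY FACE** (the
  tree's `Good` records the winding numbers `1 / 0` of the faces left / right of the cycle only): climbing a column of
  faces from below the cycle, the winding number is unchanged across an edge off the cycle (`wnd_left_sub_right`, no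
  flux) and is `1 / 0` across an edge of the cycle; by `good_or_good_reverse`, `wnd ∈ {0, ±1}` for every simple cycle,
  so «encircled» (`wnd ≠ 0`) is «`wnd` odd».
* §2 `dartWnd_hv_hvAcross` (the signed crossing of the ray from the root face `(1, 0)` — the hexagon centred at the
  south-west corner of the origin rhombus, to the right of the root half-edge `w → O` — by the half-edge leaving a
  rhombus `g` through its side `s`: `+1 / −1` exactly for the `S` side of `(k, 0)` / the `N` side of `(k, −1)`,
  `k ≤ −1`), `dartWnd_hv_hv` (the short diagonal never crosses), `exists_side_eq_rayMid_origin_iff` (**THE TWO RAYS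
  COINCIDE**: `ExcursionJordan`'s ray `rayMid (0,0) W ·` behind the root `origin = (0,0).side W` consists of exactly
  these sides), `dartWnd_hv_hvAcross_mod_two`.
* §3 (namespace `ΩG`) `exists_hvUpTo_eq_append` (the triangles after the first arc in `f`, their last triangle and their
  signed crossings), ★★ `exists_hvWalk_eq_lw_of_isB2a` — **THE HONEYCOMB WALK OF A RETURNING WALK IS A LOOP WALK**
  `w, l₁, v, l₂, v` at the triangle `v` of its return side, for every walk of class `B2a` at `f` from the origin whose
  arc in `f` is not a `θ`-corner arc, **AND THE WINDING NUMBER OF ITS LOOP ABOUT THE ROOT FACE IS THE SIGNED NUMBER OF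
  CROSSINGS OF THE RAY BEHIND THE ROOT** by the exit half-edges of the slots of the excursion polygon;
  `loopWnd_hvWalk_eq_sum_dartWnd`, `jFace_side_jOut_eq`, and ★★★ `loopWnd_hvWalk_eq_rayCountAt_mod_two`:
  **DUMINIL-COPIN–SMIRNOV'S LOOP WINDING NUMBER ≡ GLAZMAN–MANOLESCU'S RAY COUNT (mod 2)** — no weight and no planarity
  hypothesis, both sides count the same crossings.
* §4 (finite face lists `Dl ∌ (−1, 0)`, non-zero `π/3`-weight) ★★★ `loopWnd_hvWalk_ne_zero_iff_odd_rayCountAt`,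
  ★★★ `loopWnd_hvWalk_ne_zero_iff_AJ_root_ne_zero` — **ENCIRCLING ⟺ WOUND**: the loop of the honeycomb walk winds
  about the root face iff the excursion polygon winds about the midpoint of the root (∘ §1 and the tree's parity law);
  `…_eq_zero_iff_AJ_root_eq_zero`, `…_iff_midPt_root_mem_inside` (∘ the tree's Jordan curve theorem),
  ★★★ `hvWalk_mem_encircling_iff_AJ_root_ne_zero` (the honeycomb walk is an ENCIRCLING loop-class walk at `f.hv ω.1` —
  a summand of the hole-root defect of the dictionary's §15 — iff the Yang–Baxter walk is wound) and
  `not_unwoundAt_of_loopWnd_ne_zero`.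
* §5 (edition 2) THE CONVERSE DICTIONARY: `ΩG.isB2a_of_forall_fc_ne` (a walk that continues after its first arc
  in `r` and draws no further arc in `r` is of class `B2a`), ★★ `ΩG.exists_isB2a_of_nonCorner_arc` (non-zero
  `π/3`-weight, a two-triangle arc in `f`, last arc outside `f` ⇒ class `B2a` with that arc), ★
  `YBWalk.not_two_arcs_of_last_ne` (two arcs in `f` use all four sides: such a walk never returns to `∂f`), ★★
  `ΩG.exists_hvWalk_eq_of_mem_clsLoop` (∘ the dictionary's surjectivity §9 and weight criterion §10: a loop-class walk at
  a triangle of `f` whose final half-edge crosses a rhombus side is the honeycomb walk of a Yang–Baxter walk to `∂f` of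
  non-zero weight arriving from outside, `f` crossed before) and ★★★ `ΩG.exists_isB2a_of_mem_clsLoop` — **EVERY SUCH
  LOOP-CLASS WALK IS THE HONEYCOMB WALK OF A NON-`θ`-CORNER CLASS-`B2a` WALK, AND IT ENCIRCLES THE ROOT FACE IFF THAT
  WALK IS WOUND**: with §4, `ω ↦ ω.2.hvWalk` is a bijection between the wound non-`θ`-corner returning walks at `f` of
  non-zero weight and the encircling loop-class walks at the triangles of `f` ending across a rhombus side.
* §6 (edition 3) THE TWO RAYS: `exists_eq_rayCell_W_iff`, `exists_side_eq_rayMid_W_iff`, `xor_rayCell_W_iff` (the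
  boundary of the half-strip behind a `W` side = that side + the two parallel rays from its two ends),
  `even_card_filter_iff_not_succ_mod` (telescoping parity around a cycle; consecutive slots of the excursion polygon
  are the two rhombi of their common mid-edge — the tree's `ExcursionJordan`), ★★
  `ΩG.even_rayCountAt_add_rayCountAt_north` — THE EXCURSION POLYGON CROSSES THE RAYS BEHIND THE TWO ENDS OF A `W` SIDE IT
  DOES NOT CROSS WITH EQUAL PARITY (no Jordan curve theorem), ★★★ `ΩG.AJ_root_ne_zero_iff_odd_rayCountAt_north` (wound ⟺
  odd crossings of the ray from the OTHER end of the root — the count the reflected triangulation of the second hexagonal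
  angle reads) and `ΩG.loopWnd_hvWalk_ne_zero_iff_odd_rayCountAt_north`.
* §7 (edition 4) THE SECOND TRIANGULATION: transport of the walk anatomy along the row reflection `mids ↦ mirrorRow c`
  (`YBWalk.start_eq_of_mids_mirror`, `…length_arcs_eq…`, `…nth_eq…`, `…fc_eq…`, `…sIn_sOut_eq…`, `…hitIdx_eq…`,
  `…firstHitG_eq_of_mids_mirror`; `ΩG.Mv_eq_of_mids_mirror`, ★ `ΩG.isB2a_of_mids_mirror` (the returning class is
  preserved), `ΩG.arcKind_firstSideG_z1_of_mids_mirror` (`θ`-corner ↔ `(π−θ)`-corner), ★ `ΩG.rayCountAt_W_of_mids_mirror`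
  with `mirrorRow_rayMid_W` (the reflection carries the ray behind `b.side W` to the ray behind the `W` side of
  `(b.1, 2c − b.2 + 1)` — for the root row it EXCHANGES the two rays of §6)), ★★★
  `ΩG.loopWnd_hvWalk_mirror_ne_zero_iff_AJ_root_ne_zero` — for a class-`B2a` walk at `f` from the origin whose arc in `f`
  is not a `(π−θ)`-corner arc and whose reflected walk (the second-angle file's `mirrorWalkEquivMap 0`; `ΩG.exists_mirror_mids`)
  has non-zero `π/3`-weight (= the walk's `2π/3`-weight), THE LOOP OF THE REFLECTED HONEYCOMB WALK — THE WALK ON THE OTHER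
  TRIANGULATION, SEEN BY THE SECOND HEXAGONAL ANGLE — ENCIRCLES THE ROOT FACE IFF THE WALK IS WOUND. With edition 1: a wound
  returning walk whose `π/3`- and `2π/3`-weights are both non-zero is seen by at least one of the two hexagonal lattices (by
  both if its arc in `f` is straight); invisibility to both forces a vanishing weight.
* §8 (edition 5) EVERY `W`-ROOT AND THE ENCIRCLING TERM: the same transport along the translation `mids ↦ shiftBy v`
  (`YBWalk.…_of_mids_shift`, `ΩG.isB2a_of_mids_shift`, `ΩG.arcKind_firstSideG_z1_of_mids_shift` (same kind),
  `ΩG.rayCountAt_W_of_mids_shift`, `shiftBy_rayMid_W`, `ΩG.fc_ne_of_isB2a`) and ★★★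
  `ΩG.loopWnd_hvWalk_shift_ne_zero_iff_AJ_root_ne_zero` — root on the `W` side of ANY rhombus `w` with its western neighbour
  outside `Dl`: for a class-`B2a` walk `ω` at `f` with a non-`θ`-corner arc and the translated walk `ω'` of `dom (Dl − w)` from
  the origin (the dictionary's `shiftByEquiv (−w)`, §13; `ΩG.exists_shift_mids`) of non-zero weight, THE LOOP OF THE HONEYCOMB
  WALK OF `ω'` ENCIRCLES THE ROOT FACE IFF THE EXCURSION POLYGON OF `ω` WINDS ABOUT THE MIDPOINT OF `w.side W` — the form in
  which the venture lane's hole-rooted tables are organised («root W of (2, 1)»); ★★ `YBWalk.edir_mul_pwt_hvWalk_eq` /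
  `ΩG.edir_mul_pwt_hvWalk_eq` — THE ENCIRCLING TERM OF A RETURNING WALK (the summand of the dictionary's §15 at the triangle of
  its final side) IS `(2ω − 1) · crCoef (π/3) s · paraWeight`: Glazman–Manolescu's (CR) coefficient of the side times the walk's
  parafermionic weight (∘ the dictionary's §4 `paraWeight_pi_div_three` and §12 `edir_hv_hvAcross`).
* §9 (edition 6) THE `θ`-CORNER RETURNING WALKS: `ΩG.tri_fst_ne_of_corner` (a `θ`-corner returning walk returns through the
  OTHER triangle), ★★ `ΩG.exists_hvWalk_append_eq_lw_of_corner` / `ΩG.loopWnd_hvWalk_append_eq_rayCountAt_mod_two` (its honeycomb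
  walk PUSHED ACROSS THE SHORT DIAGONAL, `hvWalk ++ [T]`, is a loop walk at the arc's triangle `T`, loop winding ≡ ray count mod 2),
  ★★★ `ΩG.hvWalk_append_mem_clsLoop_of_corner` (non-zero weight: the pushed walk is a loop-class mid-edge walk of the triangle domain
  ending on the diagonal, and it ENCIRCLES THE ROOT FACE IFF THE WALK IS WOUND) and ★★★ `ΩG.exists_isB2a_corner_of_mem_clsLoop_diag`
  (conversely EVERY loop-class walk at a triangle of `f` whose final half-edge runs along the short diagonal is such a pushed walk of
  a `θ`-corner class-`B2a` walk of non-zero weight, encircling iff wound). WITH §4–§5 THE DICTIONARY OF THE TWO THIRD CLASSES IS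
  COMPLETE: every encircling loop-class walk at the two triangles of `f` — the summands of the hole-root defect at `π/3` — is
  accounted for by exactly one WOUND returning walk of non-zero weight (non-`θ`-corner ↔ ending across a side of the return triangle,
  `θ`-corner ↔ ending along the diagonal into the arc's triangle), so Duminil-Copin–Smirnov's defect at `π/3` is a sum over
  Glazman–Manolescu's wound class-`B2a` walks and nothing else.

Why (venture lane «pcv-sawmu», Tier B SEARCH 1). The dictionary files identify Glazman–Manolescu's vertex functional at
`π/3` with the sum of Duminil-Copin–Smirnov's two triangle relations and the hole-root defect with the signed weight of
the encircling loop-class walks (`YangBaxterSAWHexDictionary` §12/§15); the second-angle file, edition 6, identifies the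
returning Yang–Baxter walks with the loop-class honeycomb walks, walk by walk, «the winding side left open». This file
closes the winding side: the encircling loop-class walks through the triangles of `f` that come from Yang–Baxter walks
(those crossing `f` by a non-`θ`-corner arc) are EXACTLY the wound walks of class `B2a` of the lane's encircling-excursion
criterion (`FINDING-YB-ENCIRCLING-CRITERION.md`; the tree's `UnwoundAt`, `ΩG.AJ_root_ne_zero_iff_odd_rayCountAt`), so the
lane's census data on wound walks and its honeycomb no-cancellation census speak about the same objects.

Design notes. (1) Root at the origin (DCS's root face is `(1, 0)`; the honeycomb files fix `a = {w, O}`); other `W`-roots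
by the dictionary's translations (§13), other orientations by the lane's `PlaquetteWalkMirrorDuality`. (2) The parity
identity §3 needs neither the weight nor any topology: it is bookkeeping of crossings; the weight enters §4 only through
the self-avoidance of the triangle list (`isMidWalk_hvWalk_of_origin`), which makes the loop a simple cycle. (3) No new
definitions. (4) Imports `YangBaxterSAWHexDictionary` only (its closure holds `ExcursionJordan` and the hole-root file).

References: [DuminilCopinSmirnov2012] Lemma 1 and its proof; [GlazmanManolescu2019] §1 (p. 3, Fig. 2), Lemma 2.1;
[Glazman2015WeightedSAW] Lemma 3.1 (proof, pp. 6–7); [CourantRobbins1958] Ch. V Appendix §2; [Mccleary2006] Ch. 9 (the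
tree's Jordan curve theorem). Status: LANE THEOREM (the two walk classes of the two proofs coincide on the common
model, with the planar Jordan bound for honeycomb cycles); new only as a dictionary statement — both halves are proved
in print for their own model. Written for the venture lane «pcv-sawmu» (Tier B SEARCH 1, b-engine-1 gen 21). Editions: ed.1 = §1–§4 (landed);
ed.2 = ed.1 verbatim ⊕ §5 (appended; landed); ed.3 = ed.2 verbatim ⊕ §6 (appended; landed); ed.4 = ed.3 verbatim ⊕ §7 (appended; landed);
ed.5 = ed.4 verbatim ⊕ §8 (appended; landed); ed.6 = ed.5 verbatim ⊕ §9 (appended).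
-/

noncomputable section

open Real

namespace Literature.Probability.RandomPlanarGeometry.SAW

namespace HV

/-! ## §1. A simple cycle of the honeycomb lattice winds at most once about every face -/

section JordanBound

variable {l : List HV}

/-- **A positively oriented simple cycle of `ℍ` has winding number `0` or `1` about EVERY face** (the tree's
`Good` records this only for the faces adjacent to the cycle): climb the column of the face from below the
cycle — across an edge off the cycle the winding number does not change (`wnd_left_sub_right`, no flux), across an
edge of the cycle the two faces are the left and right faces of a dart of the cycle, of winding numbers `1` and
`0`. [folklore: the Jordan curve theorem for lattice polygons, even–odd rule]
[cite: CourantRobbins1958, Ch. V Appendix §2 (The Jordan Curve Theorem for Polygons: the even–odd rule)] -/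
theorem Good.wnd_eq_zero_or_one (hg : Good l) (hc : IsCyc l) (F : ℤ × ℤ) : wnd l F = 0 ∨ wnd l F = 1 := by
  obtain ⟨M, hM⟩ := exists_le_snd l
  -- climb the column `c + 1` from below the cycle
  have key : ∀ (c : ℤ) (k : ℕ), wnd l (c + 1, M + k) = 0 ∨ wnd l (c + 1, M + k) = 1 := by
    intro c k
    induction k with
    | zero => exact Or.inl (wnd_eq_zero_of_le fun w hw => by simpa using hM w hw)
    | succ k ih =>
      have huv : hvGraph.Adj ((c, M + k, true) : HV) ((c + 1, M + k, false) : HV) := by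
        rw [hvGraph_adj]; simp [HV.AdjRel]
      have e := wnd_left_sub_right hc.2.2 huv
      rw [leftFace_tt1, rightFace_tt1, hc.flux_eq] at e
      have eM : (M + ((k + 1 : ℕ) : ℤ)) = M + k + 1 := by push_cast; ring
      rw [eM]
      by_cases h1 : (((c, M + ↑k, true) : HV), ((c + 1, M + ↑k, false) : HV)) ∈ cdarts l
      · -- an edge of the cycle, traversed eastwards: the upper face is its left face
        have hl := hg.wnd_leftFace hc h1
        rw [leftFace_tt1] at hl
        exact Or.inr hl
      · by_cases h2 : (((c + 1, M + ↑k, false) : HV), ((c, M + ↑k, true) : HV)) ∈ cdarts l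
        · -- traversed westwards: the upper face is its right face
          have h0 : wnd l (rightFace ((c + 1, M + ↑k, false) : HV) ((c, M + ↑k, true) : HV)) = 0 := hg.2 _ h2
          have er : rightFace ((c + 1, M + ↑k, false) : HV) ((c, M + ↑k, true) : HV) = (c + 1, M + k + 1) :=
            leftFace_tt1 c (M + k)
          rw [er] at h0
          exact Or.inl h0
        · -- not an edge of the cycle: no flux, no change
          rw [if_neg h1, if_neg h2] at e
          have : wnd l (c + 1, M + k + 1) = wnd l (c + 1, M + k) := by omega
          rw [this]
          exact ih
  by_cases hF : M ≤ F.2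
  · obtain ⟨k, hk⟩ := Int.le.dest hF
    have h := key (F.1 - 1) k
    rw [sub_add_cancel, hk] at h
    exact h
  · exact Or.inl (wnd_eq_zero_of_le fun w hw => by have := hM w hw; omega)

/-- **A simple cycle of `ℍ` winds at most once about every face**: `wnd ∈ {0, 1, −1}` (positively oriented
cycles: `{0, 1}`; their reverses: `{0, −1}`). [folklore: the Jordan curve theorem for lattice polygons]
[cite: CourantRobbins1958, Ch. V Appendix §2 (The Jordan Curve Theorem for Polygons: the even–odd rule)] -/
theorem IsCyc.wnd_trichotomy (hc : IsCyc l) (F : ℤ × ℤ) : wnd l F = 0 ∨ wnd l F = 1 ∨ wnd l F = -1 := by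
  rcases good_or_good_reverse hc with hg | hg
  · rcases hg.wnd_eq_zero_or_one hc F with h | h
    · exact Or.inl h
    · exact Or.inr (Or.inl h)
  · rcases hg.wnd_eq_zero_or_one hc.reverse F with h | h
    · rw [wnd_reverse] at h; exact Or.inl (neg_eq_zero.1 h)
    · rw [wnd_reverse] at h; exact Or.inr (Or.inr (by omega))

/-- The winding number of a simple cycle about a face has absolute value at most `1`. [folklore]
[cite: CourantRobbins1958, Ch. V Appendix §2 (The Jordan Curve Theorem for Polygons: the even–odd rule)] -/
theorem IsCyc.natAbs_wnd_le_one (hc : IsCyc l) (F : ℤ × ℤ) : (wnd l F).natAbs ≤ 1 := by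
  rcases hc.wnd_trichotomy F with h | h | h <;> rw [h] <;> simp

/-- For a simple cycle, a face is encircled (`wnd ≠ 0`) iff its winding number is ODD — the bridge to
crossing parities. [folklore] [cite: CourantRobbins1958, Ch. V Appendix §2 (the even–odd rule)] -/
theorem IsCyc.wnd_ne_zero_iff_odd (hc : IsCyc l) (F : ℤ × ℤ) : wnd l F ≠ 0 ↔ Odd (wnd l F) := by
  rcases hc.wnd_trichotomy F with h | h | h <;> rw [h] <;> decide

end JordanBound

end HV

namespace YangBaxter

open MidEdge
open Literature.Barriers.CriticalPhenomena.PlaquetteWalk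
open Literature.Barriers.CriticalPhenomena (PlaquetteWalk.dom)

/-! ## §2. The half-edge across a rhombus side and the ray from Duminil-Copin–Smirnov's root face -/

section Ray

/-- **The signed crossing of DCS's ray by the half-edge leaving a rhombus through a side.** The winding number
`HV.wnd · (1, 0)` about the ROOT FACE `(1, 0)` (the hexagon centred at the south-west corner of the origin rhombus,
to the right of the root half-edge `w → O`) counts the signed crossings of the horizontal lattice half-line from
that corner to the WEST; the honeycomb dart from the triangle of `g` on its side `s` to the triangle across `s`
crosses it `+1` times if `s = S` and `g = (k, 0)`, `k ≤ −1`, `−1` times if `s = N` and `g = (k, −1)`, `k ≤ −1`, and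
otherwise not at all. [folklore] [cite: DuminilCopinSmirnov2012, proof of Lemma 1 (the winding of the loop about a)] -/
theorem dartWnd_hv_hvAcross (g : Face) (s : Side) :
    HV.dartWnd (g.hv s, g.hvAcross s) (1, 0) =
      if s = .S ∧ g.2 = 0 ∧ g.1 ≤ -1 then 1 else if s = .N ∧ g.2 = -1 ∧ g.1 ≤ -1 then -1 else 0 := by
  obtain ⟨k, j⟩ := g
  cases s <;> simp [Face.hv, Face.hvAcross, Side.tri, HV.dartWnd] <;> omega

/-- The short diagonal of a rhombus never crosses the ray: a dart between the two triangles of one rhombus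
contributes nothing to `HV.wnd · (1, 0)`. [folklore] [cite: GlazmanManolescu2019, §1 (Fig. 2: the rhombi split into triangles)] -/
theorem dartWnd_hv_hv (g : Face) (s t : Side) : HV.dartWnd (g.hv s, g.hv t) (1, 0) = 0 := by
  obtain ⟨k, j⟩ := g
  cases s <;> cases t <;> simp [Face.hv, Side.tri, HV.dartWnd]
  all_goals intro _ _; omega

/-- **The ray behind the root, both models.** The half-line from the south-west corner of the origin rhombus to
the west — `ExcursionJordan`'s ray `rayMid (0,0) W ·` behind the root mid-edge `origin = (0,0).side W` — consists
of the `S` sides of the rhombi `(−1−m, 0)`: a side `g.side s` lies on it iff `s = S`, `g = (k, 0)` or `s = N`,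
`g = (k, −1)`, with `k ≤ −1`. [folklore] [cite: CourantRobbins1958, Ch. V Appendix §2 (the even–odd rule)] -/
theorem exists_side_eq_rayMid_origin_iff (g : Face) (s : Side) :
    (∃ m : ℕ, g.side s = rayMid ((0 : ℤ), (0 : ℤ)) .W m) ↔
      (s = .S ∧ g.2 = 0 ∧ g.1 ≤ -1) ∨ (s = .N ∧ g.2 = -1 ∧ g.1 ≤ -1) := by
  obtain ⟨k, j⟩ := g
  constructor
  · rintro ⟨m, hm⟩
    cases s <;> simp [Face.side, rayMid, rayCell, raySide] at hm ⊢ <;> omega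
  · rintro (⟨rfl, h2, h1⟩ | ⟨rfl, h2, h1⟩)
    · refine ⟨(-1 - k).toNat, ?_⟩
      simp only [Face.side, rayMid, rayCell, raySide] at h2 ⊢
      subst h2
      congr 1; omega
    · refine ⟨(-1 - k).toNat, ?_⟩
      simp only [Face.side, rayMid, rayCell, raySide] at h2 ⊢
      subst h2
      congr 1; omega

open scoped Classical in
/-- Mod `2`, the signed crossing is the indicator of the ray. [folklore] [cite: CourantRobbins1958, Ch. V Appendix §2 (the even–odd rule)] -/
theorem dartWnd_hv_hvAcross_mod_two (g : Face) (s : Side) :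
    ((HV.dartWnd (g.hv s, g.hvAcross s) (1, 0) : ℤ) : ZMod 2) =
      if (∃ m : ℕ, g.side s = rayMid ((0 : ℤ), (0 : ℤ)) .W m) then 1 else 0 := by
  rw [dartWnd_hv_hvAcross]
  by_cases hS : s = .S ∧ g.2 = 0 ∧ g.1 ≤ -1
  · rw [if_pos hS, if_pos ((exists_side_eq_rayMid_origin_iff g s).2 (Or.inl hS))]; simp
  · rw [if_neg hS]
    by_cases hN : s = .N ∧ g.2 = -1 ∧ g.1 ≤ -1
    · rw [if_pos hN, if_pos ((exists_side_eq_rayMid_origin_iff g s).2 (Or.inr hN))]; decide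
    · rw [if_neg hN, if_neg (fun h => by
        rcases (exists_side_eq_rayMid_origin_iff g s).1 h with h | h
        · exact hS h
        · exact hN h)]
      simp

end Ray

/-! ## §3. The honeycomb loop of a class-`B2a` walk and its winding number about the root face -/

namespace ΩG

open YBWalk

open private fc_fh fc_ne fh_add_Mv
  from Literature.Probability.RandomPlanarGeometry.YangBaxterSAWGeneralDomain

variable {D : Set Face} {f : Face} {ω : ΩG D origin f} {hr : RootedFace D origin f}

/-- The triangles after the first arc in `f`: for a walk from the origin to a side of `f` and `F + 1 ≤ i ≤ n`
(`F` the first hit of `∂f`, `n` the number of arcs) the triangle list of the first `i` arcs is that of the first `F + 1` arcs followed by a list `L`, the list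
`T₁ :: L` (`T₁` the exit triangle of the arc in `f`) ends with the exit triangle of arc `i − 1`, and the signed
crossings of Duminil-Copin–Smirnov's ray by its darts are those of the half-edges across the exit sides of the
arcs `F, …, i − 2`. [cite: GlazmanManolescu2019, §1 (Fig. 2: the walk as a hexagonal-lattice walk)]
[cite: Glazman2015WeightedSAW, Lemma 3.1 (proof, pp. 6–7: the excursion of a walk of the returning class)] -/
theorem exists_hvUpTo_eq_append {i : ℕ} (hFi : ω.2.firstHitG + 1 ≤ i) (hi : i ≤ ω.2.arcs.length) :
    ∃ L : List HV, ω.2.hvUpTo i = ω.2.hvUpTo (ω.2.firstHitG + 1) ++ L ∧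
      ((ω.2.fc ω.2.firstHitG).hv (ω.2.sOut ω.2.firstHitG) :: L).getLast (List.cons_ne_nil _ _) =
        (ω.2.fc (i - 1)).hv (ω.2.sOut (i - 1)) ∧
      HV.dwnd (HV.pdarts ((ω.2.fc ω.2.firstHitG).hv (ω.2.sOut ω.2.firstHitG) :: L)) (1, 0) =
        ∑ k ∈ Finset.Ico ω.2.firstHitG (i - 1),
          HV.dartWnd ((ω.2.fc k).hv (ω.2.sOut k), (ω.2.fc k).hvAcross (ω.2.sOut k)) (1, 0) := by
  induction i, hFi using Nat.le_induction with
  | base =>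
    refine ⟨[], by simp, ?_, ?_⟩
    · simp
    · simp
  | succ i hFi ih =>
    obtain ⟨L, hL, hlast, hsum⟩ := ih (by omega)
    have hi' : i < ω.2.arcs.length := by omega
    have hsucc : i - 1 + 1 = i := by omega
    -- the first triangle of arc `i` is the triangle across the exit side of arc `i - 1`
    have hacross : (ω.2.fc i).hv (ω.2.sIn i) = (ω.2.fc (i - 1)).hvAcross (ω.2.sOut (i - 1)) := by
      have e := acrossOut_eq_hv_succ (γ := ω.2) (i := i - 1) (by omega)
      rw [hsucc] at e
      exact e.symm
    refine ⟨L ++ ω.2.arcHV i, ?_, ?_, ?_⟩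
    · rw [YBWalk.hvUpTo_succ, hL, List.append_assoc]
    · apply Option.some_injective
      rw [← List.getLast?_eq_some_getLast, Nat.add_sub_cancel, ← List.cons_append, List.getLast?_append,
        getLast?_arcHV, Option.some_or]
    · rw [Nat.add_sub_cancel, ← List.cons_append]
      have htop : ∑ k ∈ Finset.Ico ω.2.firstHitG i,
            HV.dartWnd ((ω.2.fc k).hv (ω.2.sOut k), (ω.2.fc k).hvAcross (ω.2.sOut k)) (1, 0) =
          (∑ k ∈ Finset.Ico ω.2.firstHitG (i - 1),
            HV.dartWnd ((ω.2.fc k).hv (ω.2.sOut k), (ω.2.fc k).hvAcross (ω.2.sOut k)) (1, 0)) +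
          HV.dartWnd ((ω.2.fc (i - 1)).hv (ω.2.sOut (i - 1)), (ω.2.fc (i - 1)).hvAcross (ω.2.sOut (i - 1))) (1, 0) := by
        rw [← Finset.sum_Ico_succ_top (by omega), hsucc]
      rw [htop, ← hsum, ← hacross]
      unfold YBWalk.arcHV
      split_ifs with ht
      · rw [HV.pdarts_append_singleton _ (List.cons_ne_nil _ _), HV.dwnd_append, hlast]
        simp
      · rw [HV.pdarts_append_cons_cons, HV.pdarts_append_singleton _ (List.cons_ne_nil _ _), HV.dwnd_append,
          HV.dwnd_append, hlast]
        simp [dartWnd_hv_hv]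

/-- ★★ **THE HONEYCOMB LOOP OF A RETURNING WALK.** Root at the origin (`(−1, 0) ∉ D`), `ω` a walk of class
`B2a` at the rhombus `f` (first hit of `∂f`, ONE arc of `f` from `z₀` to `z₁`, an excursion outside `f`, return to
the side `ω.1` of `f`, where it stops) whose arc in `f` is not a `θ`-corner arc (so it crossed both triangles of
`f`). Then its honeycomb walk is a LOOP WALK `w, l₁, v, l₂, v` at the triangle `v = f.hv ω.1` of its return side
(`HV.lw`, the format of Duminil-Copin–Smirnov's third class), the loop `v :: l₂` consisting of the excursion's
triangles (preceded by the other triangle of `f` when `v` is the entry triangle), and THE WINDING NUMBER OF THE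
LOOP ABOUT THE ROOT FACE `(1, 0)` IS THE SIGNED NUMBER OF CROSSINGS OF THE RAY BEHIND THE ROOT by the half-edges
across the exit side `z₁` and the exit sides of the excursion arcs (the return side included).
[cite: GlazmanManolescu2019, §1 (Fig. 2), Lemma 2.1] [cite: Glazman2015WeightedSAW, Lemma 3.1 (proof, pp. 6–7)]
[cite: DuminilCopinSmirnov2012, proof of Lemma 1 (the walks passing all three mid-edges of a vertex; the winding of the loop)] -/
theorem exists_hvWalk_eq_lw_of_isB2a (hD : ((-1 : ℤ), (0 : ℤ)) ∉ D) (h : ω.IsB2a)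
    (hκ : arcKind ω.2.firstSideG (ω.z1 hr h) ≠ .corner) :
    ∃ l₁ l₂ : List HV, f.hv ω.1 ∉ l₁ ∧ l₂ ≠ [] ∧ ω.2.hvWalk = HV.lw l₁ (f.hv ω.1) l₂ ∧
      HV.wnd (f.hv ω.1 :: l₂) (1, 0) =
        ∑ j ∈ Finset.range ω.Mv,
          HV.dartWnd ((ω.2.fc (ω.2.firstHitG + j)).hv (ω.2.sOut (ω.2.firstHitG + j)),
            (ω.2.fc (ω.2.firstHitG + j)).hvAcross (ω.2.sOut (ω.2.firstHitG + j))) (1, 0) := by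
  -- bookkeeping of the class `B2a`
  have hfh : ω.2.firstHitG < ω.2.arcs.length := ω.fh_lt h
  have hM : 3 ≤ ω.Mv := three_le_Mv hr h
  have hFM : ω.2.firstHitG + ω.Mv = ω.2.arcs.length := fh_add_Mv h
  obtain ⟨hfc, hsIn, hsOut⟩ := fc_fh ω hr h
  have hz1 : ω.2.sOut ω.2.firstHitG = ω.z1 hr h := hsOut
  have hn : 0 < ω.2.arcs.length := by omega
  have hst : ω.2.firstSideG ≠ ω.z1 hr h := by
    rw [← hsIn, ← hz1]; exact (YBWalk.side_sIn hfh).2.2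
  have htri : ω.2.firstSideG.tri ≠ (ω.z1 hr h).tri := fun e => hκ ((arcKind_eq_corner_iff hst).2 e)
  -- the excursion triangles
  obtain ⟨L, hL, hlast, hsum⟩ :=
    exists_hvUpTo_eq_append (ω := ω) (i := ω.2.arcs.length) (by omega) le_rfl
  -- the last triangle beyond the final mid-edge is the return triangle `v = f.hv ω.1`
  have hch : ω.2.fc (ω.2.arcs.length - 1) ≠ f := fc_ne ω hr h (by omega) (by omega)
  have hv : ω.2.acrossOut (ω.2.arcs.length - 1) = f.hv ω.1 := acrossOut_last_eq_hv rfl hn hch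
  -- the arc in `f` crosses both triangles
  have harc : ω.2.arcHV ω.2.firstHitG = [f.hv ω.2.firstSideG, f.hv (ω.z1 hr h)] := by
    unfold YBWalk.arcHV
    rw [hfc, hsIn, hz1, if_neg htri]
  have hwalk : ω.2.hvWalk = HV.wOut :: (ω.2.hvUpTo ω.2.firstHitG ++ [f.hv ω.2.firstSideG, f.hv (ω.z1 hr h)] ++
      L ++ [f.hv ω.1]) := by
    rw [ω.2.hvWalk_of_origin hD hn, YBWalk.hvInner, hL, YBWalk.hvUpTo_succ, harc, hv]
  -- the triangles before the first hit are not triangles of `f`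
  have hnot : ∀ s : Side, f.hv s ∉ ω.2.hvUpTo ω.2.firstHitG := by
    intro s hs
    obtain ⟨k, hk, t, he⟩ := exists_fc_of_mem_hvUpTo hs
    have hkf : ω.2.fc k ≠ f := by
      intro e
      have hk' : k < ω.2.arcs.length := by omega
      have hface := (YBWalk.arcFace_arcAt hk').1
      rw [YBWalk.arcAt_eq hk', e, ← ω.2.nth_eq_getElem, ← ω.2.nth_eq_getElem] at hface
      exact ω.2.arcFace_ne_of_lt_firstHitG hk hk' hface
    exact hkf (Face.hv_eq_hv_iff.1 he.symm).1
  -- the closing dart of the loop crosses the return side: it is the half-edge across the last exit side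
  have hclose : HV.dartWnd ((ω.2.fc (ω.2.arcs.length - 1)).hv (ω.2.sOut (ω.2.arcs.length - 1)), f.hv ω.1) (1, 0) =
      HV.dartWnd ((ω.2.fc (ω.2.arcs.length - 1)).hv (ω.2.sOut (ω.2.arcs.length - 1)),
        (ω.2.fc (ω.2.arcs.length - 1)).hvAcross (ω.2.sOut (ω.2.arcs.length - 1))) (1, 0) := by
    rw [← hv]; rfl
  -- the total signed crossing, reindexed over the slots of the excursion polygon
  have htotal : (∑ k ∈ Finset.Ico ω.2.firstHitG (ω.2.arcs.length - 1),
        HV.dartWnd ((ω.2.fc k).hv (ω.2.sOut k), (ω.2.fc k).hvAcross (ω.2.sOut k)) (1, 0)) +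
      HV.dartWnd ((ω.2.fc (ω.2.arcs.length - 1)).hv (ω.2.sOut (ω.2.arcs.length - 1)),
        (ω.2.fc (ω.2.arcs.length - 1)).hvAcross (ω.2.sOut (ω.2.arcs.length - 1))) (1, 0) =
      ∑ j ∈ Finset.range ω.Mv,
        HV.dartWnd ((ω.2.fc (ω.2.firstHitG + j)).hv (ω.2.sOut (ω.2.firstHitG + j)),
          (ω.2.fc (ω.2.firstHitG + j)).hvAcross (ω.2.sOut (ω.2.firstHitG + j))) (1, 0) := by
    rw [← Finset.sum_Ico_succ_top (by omega), show ω.2.arcs.length - 1 + 1 = ω.2.arcs.length by omega,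
      Finset.sum_Ico_eq_sum_range, show ω.2.arcs.length - ω.2.firstHitG = ω.Mv by omega]
  -- which triangle of `f` is the return triangle?
  by_cases hv1 : (ω.1).tri = (ω.z1 hr h).tri
  · -- `v` is the EXIT triangle `T₁`: loop = `T₁ :: L`
    have hvT : f.hv ω.1 = f.hv (ω.z1 hr h) := Face.hv_eq_hv_iff.2 ⟨rfl, hv1⟩
    have hT1 : (ω.2.fc ω.2.firstHitG).hv (ω.2.sOut ω.2.firstHitG) = f.hv ω.1 := by rw [hfc, hz1, hvT]
    have hL0 : L ≠ [] := by
      rintro rfl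
      rw [List.getLast_singleton] at hlast
      rw [hT1] at hlast
      exact hch (Face.hv_eq_hv_iff.1 hlast).1.symm
    refine ⟨ω.2.hvUpTo ω.2.firstHitG ++ [f.hv ω.2.firstSideG], L, ?_, hL0, ?_, ?_⟩
    · rw [List.mem_append, List.mem_singleton, not_or]
      refine ⟨hnot ω.1, fun e => htri ?_⟩
      rw [hvT] at e
      exact ((Face.hv_eq_hv_iff.1 e).2).symm
    · rw [hwalk, HV.lw, hvT]
      simp
    · rw [← hT1] at hclose ⊢
      rw [HV.wnd_eq_dwnd, HV.cdarts_eq (List.cons_ne_nil _ _), HV.dwnd_append, hsum, hlast, List.head_cons, HV.dwnd_cons,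
        HV.dwnd_nil, add_zero, hclose, htotal]
  · -- `v` is the ENTRY triangle `T₀`: loop = `T₀ :: T₁ :: L`, the first dart being the short diagonal
    have hv0 : (ω.1).tri = ω.2.firstSideG.tri := by
      revert hv1 htri
      cases (ω.1).tri <;> cases ω.2.firstSideG.tri <;> cases (ω.z1 hr h).tri <;> simp
    have hvT : f.hv ω.1 = f.hv ω.2.firstSideG := Face.hv_eq_hv_iff.2 ⟨rfl, hv0⟩
    have hT1 : (ω.2.fc ω.2.firstHitG).hv (ω.2.sOut ω.2.firstHitG) = f.hv (ω.z1 hr h) := by rw [hfc, hz1]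
    refine ⟨ω.2.hvUpTo ω.2.firstHitG, f.hv (ω.z1 hr h) :: L, hvT ▸ hnot _, List.cons_ne_nil _ _, ?_, ?_⟩
    · rw [hwalk, HV.lw, hvT]
      simp
    · rw [hvT] at hclose ⊢
      rw [HV.wnd_eq_dwnd, HV.cdarts_eq (List.cons_ne_nil _ _), HV.dwnd_append, List.head_cons, HV.pdarts_cons_cons,
        HV.dwnd_cons, dartWnd_hv_hv, zero_add, List.getLast_cons (List.cons_ne_nil _ _), ← hT1, hsum, hlast,
        HV.dwnd_cons, HV.dwnd_nil, add_zero, hclose, htotal]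

/-- ★★ **THE LOOP WINDING NUMBER OF THE HONEYCOMB WALK OF A RETURNING WALK** (Duminil-Copin–Smirnov's
`loopWnd`, the integer deciding whether the pair of the walk cancels in the vertex relation — the lane's
`HexSAWVertexRelationHoleRoot`): for a walk of class `B2a` at `f` from the origin whose arc in `f` is not a
`θ`-corner arc, it is the signed number of crossings of the ray behind the root by the exit half-edges of the slots
of Glazman–Manolescu's excursion polygon. [cite: DuminilCopinSmirnov2012, proof of Lemma 1 (the winding of the loop)]
[cite: GlazmanManolescu2019, §1 (Fig. 2), Lemma 2.1] [cite: Glazman2015WeightedSAW, Lemma 3.1 (proof, pp. 6–7)] -/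
theorem loopWnd_hvWalk_eq_sum_dartWnd (hD : ((-1 : ℤ), (0 : ℤ)) ∉ D) (h : ω.IsB2a)
    (hκ : arcKind ω.2.firstSideG (ω.z1 hr h) ≠ .corner) :
    HV.loopWnd (f.hv ω.1) ω.2.hvWalk =
      ∑ j ∈ Finset.range ω.Mv,
        HV.dartWnd ((ω.2.fc (ω.2.firstHitG + j)).hv (ω.2.sOut (ω.2.firstHitG + j)),
          (ω.2.fc (ω.2.firstHitG + j)).hvAcross (ω.2.sOut (ω.2.firstHitG + j))) (1, 0) := by
  obtain ⟨l₁, l₂, hv, -, he, hw⟩ := exists_hvWalk_eq_lw_of_isB2a (hr := hr) hD h hκ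
  rw [he, HV.loopWnd_lw hv, hw]

/-- The exit mid-edge of slot `j` of the excursion polygon is the exit side of arc `F + j` (slot `0`: the arc in
`f`, exit side `z₁`). [cite: Glazman2015WeightedSAW, Lemma 3.1 (proof, pp. 6–7: the classes of walks through a rhombus)] -/
theorem jFace_side_jOut_eq (h : ω.IsB2a) (j : ℕ) :
    (ω.jFace h j).side (ω.jOut hr h j) = (ω.2.fc (ω.2.firstHitG + j)).side (ω.2.sOut (ω.2.firstHitG + j)) := by
  by_cases hj0 : j = 0
  · subst hj0
    obtain ⟨hfc, -, hsOut⟩ := fc_fh ω hr h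
    simp only [ΩG.jFace, ΩG.jOut, Nat.add_zero, hfc, hsOut]
    rfl
  · simp only [ΩG.jFace, ΩG.jOut, if_neg hj0]

open scoped Classical in
/-- ★★★ **DUMINIL-COPIN–SMIRNOV'S LOOP WINDING NUMBER IS GLAZMAN–MANOLESCU'S RAY COUNT MOD 2.** For a walk of
class `B2a` at `f` from the origin whose arc in `f` is not a `θ`-corner arc: the winding number about the root face
of the loop of its honeycomb walk is congruent mod `2` to the number of times its excursion polygon crosses the
lattice half-line behind the root (`ExcursionJordan`'s `rayCountAt` at `(0,0)`, side `W`). No weight or planarity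
hypothesis: both sides count the same crossings, once with signs and once without.
[cite: DuminilCopinSmirnov2012, proof of Lemma 1] [cite: CourantRobbins1958, Ch. V Appendix §2 (The Jordan Curve Theorem for Polygons: the even–odd rule)]
[cite: Glazman2015WeightedSAW, Lemma 3.1 (proof, pp. 6–7)] -/
theorem loopWnd_hvWalk_eq_rayCountAt_mod_two (hD : ((-1 : ℤ), (0 : ℤ)) ∉ D) (h : ω.IsB2a)
    (hκ : arcKind ω.2.firstSideG (ω.z1 hr h) ≠ .corner) :
    ((HV.loopWnd (f.hv ω.1) ω.2.hvWalk : ℤ) : ZMod 2) = (ω.rayCountAt hr h ((0 : ℤ), (0 : ℤ)) .W : ZMod 2) := by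
  rw [loopWnd_hvWalk_eq_sum_dartWnd (hr := hr) hD h hκ, Int.cast_sum, ΩG.rayCountAt, Finset.natCast_card_filter]
  refine Finset.sum_congr rfl fun j _ => ?_
  rw [dartWnd_hv_hvAcross_mod_two, jFace_side_jOut_eq (hr := hr) h j]

end ΩG

/-! ## §4. Encircling ⟺ wound: the honeycomb loop winds about the root face iff the excursion polygon winds
about the root -/

namespace ΩG

open YBWalk HV

open private fc_ne kindsIn_of_isB2a
  from Literature.Probability.RandomPlanarGeometry.YangBaxterSAWGeneralDomain

variable {Dl : List Face} {f : Face} {ω : ΩG (PlaquetteWalk.dom Dl) origin f}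
  {hr : RootedFace (PlaquetteWalk.dom Dl) origin f}

/-- ★★★ **ENCIRCLING ⟺ ODD CROSSINGS.** Finite face list `Dl ∌ (−1, 0)`, root at the origin, `ω` a walk of class
`B2a` at `f` of non-zero `π/3`-weight whose arc in `f` is not a `θ`-corner arc. The loop of its honeycomb walk (a
simple cycle of `ℍ`, winding number `0` or `±1` about every face, §1) WINDS ABOUT THE ROOT FACE iff the excursion
polygon crosses the half-line behind the root an ODD number of times. [cite: DuminilCopinSmirnov2012, proof of Lemma 1 (the winding of the loop about a)]
[cite: CourantRobbins1958, Ch. V Appendix §2 (The Jordan Curve Theorem for Polygons: the even–odd rule)]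
[cite: Glazman2015WeightedSAW, Lemma 3.1 (proof, pp. 6–7)] -/
theorem loopWnd_hvWalk_ne_zero_iff_odd_rayCountAt (hD : ((-1 : ℤ), (0 : ℤ)) ∉ Dl) (h : ω.IsB2a)
    (hκ : arcKind ω.2.firstSideG (ω.z1 hr h) ≠ .corner) (hw : ω.2.weight (fun _ => π / 3) ≠ 0) :
    HV.loopWnd (f.hv ω.1) ω.2.hvWalk ≠ 0 ↔ Odd (ω.rayCountAt hr h ((0 : ℤ), (0 : ℤ)) .W) := by
  have hD' : ((-1 : ℤ), (0 : ℤ)) ∉ PlaquetteWalk.dom Dl := hD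
  have hDF : ((-1 : ℤ), (0 : ℤ)) ∉ Dl.toFinset := fun e => hD (List.mem_toFinset.1 e)
  obtain ⟨l₁, l₂, hv, hl₂, he, -⟩ := exists_hvWalk_eq_lw_of_isB2a (hr := hr) hD' h hκ
  have hV : ∀ g ∈ PlaquetteWalk.dom Dl, ∀ s : Side, g.hv s ∈ triSet Dl.toFinset :=
    fun g hg s => hv_mem_triSet (List.mem_toFinset.2 hg) s
  have hP := ω.2.isMidWalk_hvWalk_of_origin hD' hV hw
  rw [he] at hP
  have hc : HV.IsCyc (f.hv ω.1 :: l₂) := HV.lw_isCyc (wOut_not_mem_triSet hDF) hP hl₂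
  have hpar := loopWnd_hvWalk_eq_rayCountAt_mod_two (hr := hr) hD' h hκ
  rw [he, HV.loopWnd_lw hv] at hpar ⊢
  rw [hc.wnd_ne_zero_iff_odd, ← ZMod.intCast_eq_one_iff_odd, hpar, ZMod.natCast_eq_one_iff_odd]

/-- ★★★ **ENCIRCLING ⟺ WOUND: DUMINIL-COPIN–SMIRNOV'S ENCIRCLING LOOP CLASS IS GLAZMAN–MANOLESCU'S WOUND
RETURNING CLASS, walk by walk.** Under the same hypotheses, the loop of the honeycomb walk winds about the root face
(`loopWnd ≠ 0`: the walk's pair does NOT cancel in the vertex relation at the triangle `f.hv ω.1` — the lane's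
`HexSAWVertexRelationHoleRoot.pair_sum_of_wnd_ne_zero`) iff the excursion polygon of the Yang–Baxter walk winds
about the midpoint of the root mid-edge (`AJ ≠ 0`: the summand condition negated in `UnwoundAt`, i.e. the walk's
group does not cancel in Glazman–Manolescu's grouping — the tree's `ΩG.G_add_G_rev_of_wound`).
[cite: DuminilCopinSmirnov2012, proof of Lemma 1 («we used the fact that a is on the boundary and Ω is simply connected»)]
[cite: GlazmanManolescu2019, Lemma 2.1 (statement, "in the form given in [Gl]")] [cite: Glazman2015WeightedSAW, Lemma 3.1 (proof, pp. 6–7)]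
[cite: CourantRobbins1958, Ch. V Appendix §2 (the even–odd rule)] -/
theorem loopWnd_hvWalk_ne_zero_iff_AJ_root_ne_zero (hD : ((-1 : ℤ), (0 : ℤ)) ∉ Dl) (h : ω.IsB2a)
    (hκ : arcKind ω.2.firstSideG (ω.z1 hr h) ≠ .corner) (hw : ω.2.weight (fun _ => π / 3) ≠ 0) :
    HV.loopWnd (f.hv ω.1) ω.2.hvWalk ≠ 0 ↔ ω.AJ hr h (toC (midPt origin)) ≠ 0 := by
  rw [loopWnd_hvWalk_ne_zero_iff_odd_rayCountAt hD h hκ hw,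
    AJ_root_ne_zero_iff_odd_rayCountAt (hr := hr) h (b := ((0 : ℤ), (0 : ℤ))) (τ := .W) rfl]

/-- Complementary form: the pair of the honeycomb walk cancels (`loopWnd = 0`) iff the excursion polygon is unwound
about the root (`AJ = 0`). [cite: DuminilCopinSmirnov2012, proof of Lemma 1] [cite: GlazmanManolescu2019, Lemma 2.1]
[cite: Glazman2015WeightedSAW, Lemma 3.1 (proof, pp. 6–7)] -/
theorem loopWnd_hvWalk_eq_zero_iff_AJ_root_eq_zero (hD : ((-1 : ℤ), (0 : ℤ)) ∉ Dl) (h : ω.IsB2a)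
    (hκ : arcKind ω.2.firstSideG (ω.z1 hr h) ≠ .corner) (hw : ω.2.weight (fun _ => π / 3) ≠ 0) :
    HV.loopWnd (f.hv ω.1) ω.2.hvWalk = 0 ↔ ω.AJ hr h (toC (midPt origin)) = 0 := by
  have e := loopWnd_hvWalk_ne_zero_iff_AJ_root_ne_zero hD h hκ hw
  tauto

/-- «Inside» form: the loop of the honeycomb walk winds about the root face iff the midpoint of the root mid-edge lies
in the inside (`IsJordanLoop.inside`) of the excursion polygon. [cite: Mccleary2006, Ch. 9, p. 129 (The Jordan Curve Theorem)]
[cite: DuminilCopinSmirnov2012, proof of Lemma 1] [cite: CourantRobbins1958, Ch. V Appendix §2 (the even–odd rule)] -/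
theorem loopWnd_hvWalk_ne_zero_iff_midPt_root_mem_inside (hD : ((-1 : ℤ), (0 : ℤ)) ∉ Dl) (h : ω.IsB2a)
    (hκ : arcKind ω.2.firstSideG (ω.z1 hr h) ≠ .corner) (hw : ω.2.weight (fun _ => π / 3) ≠ 0) :
    HV.loopWnd (f.hv ω.1) ω.2.hvWalk ≠ 0 ↔
      toC (midPt origin) ∈ Literature.Topology.PlaneTopology.IsJordanLoop.inside (polygonLoop (ω.pJlist hr h)) := by
  rw [loopWnd_hvWalk_ne_zero_iff_odd_rayCountAt hD h hκ hw,
    midPt_root_mem_inside_iff_odd_rayCountAt (hr := hr) h (b := ((0 : ℤ), (0 : ℤ))) (τ := .W) rfl]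

/-- ★★★ **THE DICTIONARY OF THE THIRD CLASS, BOTH HALVES.** For `Dl ∌ (−1, 0)`, root at the origin and a walk `ω` of
class `B2a` at `f` with non-zero `π/3`-weight and a non-`θ`-corner arc in `f`: its honeycomb walk is a loop-class walk of
the triangle domain at the triangle `f.hv ω.1` (edition 6 of the second-angle file, `YBWalk.hvWalk_mem_clsLoop_of_nonCorner_arc`),
and it is an ENCIRCLING one — a summand of the lane's hole-root defect `vertexFunctional_printed_pi_div_three_eq_sum_encircling`
— iff the Yang–Baxter walk is WOUND about the root. [cite: GlazmanManolescu2019, §1 (θ = π/3), Lemma 2.1]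
[cite: DuminilCopinSmirnov2012, Lemma 1 and its proof] [cite: Glazman2015WeightedSAW, Lemma 3.1 (proof, pp. 6–7)] -/
theorem hvWalk_mem_encircling_iff_AJ_root_ne_zero (hD : ((-1 : ℤ), (0 : ℤ)) ∉ Dl) (h : ω.IsB2a)
    (hκ : arcKind ω.2.firstSideG (ω.z1 hr h) ≠ .corner) (hw : ω.2.weight (fun _ => π / 3) ≠ 0) :
    ω.2.hvWalk ∈ (clsLoop (triSet Dl.toFinset) (f.hv ω.1)).filter (fun P => HV.loopWnd (f.hv ω.1) P ≠ 0) ↔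
      ω.AJ hr h (toC (midPt origin)) ≠ 0 := by
  have hfh : ω.2.firstHitG < ω.2.arcs.length := ω.fh_lt h
  have hM : 3 ≤ ω.Mv := three_le_Mv hr h
  have hMv : ω.Mv = ω.2.arcs.length - ω.2.firstHitG := rfl
  have hD' : ((-1 : ℤ), (0 : ℤ)) ∉ PlaquetteWalk.dom Dl := hD
  have hV : ∀ g ∈ PlaquetteWalk.dom Dl, ∀ s : Side, g.hv s ∈ triSet Dl.toFinset :=
    fun g hg s => hv_mem_triSet (List.mem_toFinset.2 hg) s
  -- the honeycomb walk is loop-class at the return triangle (as in the second-angle file, §10)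
  have hmem : ω.2.hvWalk ∈ clsLoop (triSet Dl.toFinset) (f.hv ω.1) := by
    have harc : arcKind ω.2.firstSideG (ω.z1 hr h) ∈ ω.2.kindsIn f := by
      rw [kindsIn_of_isB2a ω hr h]
      exact List.mem_singleton.2 rfl
    unfold clsLoop
    rw [Finset.mem_filter]
    refine ⟨mem_midWalks_iff.2 (ω.2.isMidWalk_hvWalk_of_origin hD' hV hw), ?_, ?_⟩
    · rw [ω.2.finalDart_hvWalk_of_origin hD' (by omega)]
      exact YBWalk.acrossOut_last_eq_hv rfl (by omega) (fc_ne ω hr h (by omega) (by omega))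
    · rw [ω.2.inner_hvWalk_of_origin hD']
      exact ω.2.hv_mem_hvInner_of_kindsIn (Or.inl ⟨_, hκ, harc⟩) ω.1
  rw [Finset.mem_filter, loopWnd_hvWalk_ne_zero_iff_AJ_root_ne_zero hD h hκ hw]
  exact ⟨fun h' => h'.2, fun h' => ⟨hmem, h'⟩⟩

/-- A wound class-`B2a` walk seen from the honeycomb side: if the loop of the honeycomb walk of such a walk winds about
the root face, the root is NOT unwound at `f` (the tree's `UnwoundAt` fails, so Glazman–Manolescu's grouping leaves a
defect group at `f`). [cite: GlazmanManolescu2019, Lemma 2.1 (statement, "in the form given in [Gl]")]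
[cite: Glazman2015WeightedSAW, Lemma 3.1 (proof, pp. 6–7)] [cite: DuminilCopinSmirnov2012, proof of Lemma 1] -/
theorem not_unwoundAt_of_loopWnd_ne_zero (hD : ((-1 : ℤ), (0 : ℤ)) ∉ Dl) (h : ω.IsB2a)
    (hκ : arcKind ω.2.firstSideG (ω.z1 hr h) ≠ .corner) (hw : ω.2.weight (fun _ => π / 3) ≠ 0)
    (hne : HV.loopWnd (f.hv ω.1) ω.2.hvWalk ≠ 0) : ¬UnwoundAt (PlaquetteWalk.dom Dl) origin f :=
  fun hU => (loopWnd_hvWalk_ne_zero_iff_AJ_root_ne_zero hD h hκ hw).1 hne (hU hr ω h)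

end ΩG


/-! ## §5. The converse dictionary (edition 2): every encircling-type loop-class walk through a rhombus side is a
non-`θ`-corner returning Yang–Baxter walk, encircling ⟺ wound -/

section Converse

/-- If the triangle across the side `s` of `g` is a triangle of `f`, then that side is a side of `f` lying on
that triangle. [cite: GlazmanManolescu2019, §1 (Fig. 2)] -/
theorem exists_side_of_hvAcross_eq_hv {g f : Face} {s σ : Side} (h : g.hvAcross s = f.hv σ) :
    ∃ t : Side, g.side s = f.side t ∧ t.tri = σ.tri := by
  obtain ⟨k, j⟩ := g
  obtain ⟨k', j'⟩ := f
  cases s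
  · refine ⟨.E, ?_, ?_⟩ <;> cases σ <;>
      simp [Face.hvAcross, Face.hv, Side.tri, Face.side] at h ⊢ <;> omega
  · refine ⟨.W, ?_, ?_⟩ <;> cases σ <;>
      simp [Face.hvAcross, Face.hv, Side.tri, Face.side] at h ⊢ <;> omega
  · refine ⟨.N, ?_, ?_⟩ <;> cases σ <;>
      simp [Face.hvAcross, Face.hv, Side.tri, Face.side] at h ⊢ <;> omega
  · refine ⟨.S, ?_, ?_⟩ <;> cases σ <;>
      simp [Face.hvAcross, Face.hv, Side.tri, Face.side] at h ⊢ <;> omega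

/-- Two distinct sides on one triangle are all its sides: a third side on the same triangle is one of them.
[cite: GlazmanManolescu2019, §1 (Fig. 2: each triangle carries two sides of its rhombus)] -/
theorem Side.eq_or_eq_of_tri_eq {t s₁ s₂ : Side} (h₁ : t.tri = s₁.tri) (h₂ : s₁.tri = s₂.tri) (hne : s₁ ≠ s₂) :
    t = s₁ ∨ t = s₂ := by
  cases t <;> cases s₁ <;> cases s₂ <;> simp_all [Side.tri]

namespace YBWalk

variable {D : Set Face} {a z : MidEdge}

/-- The face of the `i`-th arc, read through `arcFace` of its two mid-edges. [folklore]
[cite: GlazmanManolescu2019, §1 (an arc joins two sides of one rhombus)] -/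
theorem arcFace_nth_eq_fc (γ : YBWalk D a z) {i : ℕ} (hi : i < γ.arcs.length) :
    arcFace (γ.nth i, γ.nth (i + 1)) = some (γ.fc i) := by
  have h := (arcFace_arcAt hi).1
  rwa [arcAt_eq hi, ← γ.nth_eq_getElem, ← γ.nth_eq_getElem] at h

/-- A rhombus visited by the walk has non-zero local weight when the walk has. [cite: GlazmanManolescu2019, §1 (the weight is the product over the rhombi)] -/
theorem localWeight_kindsIn_ne_zero_of_weight_ne_zero (γ : YBWalk D a z) {Θ : ℤ → ℝ} (hw : γ.weight Θ ≠ 0)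
    {i : ℕ} (hi : i < γ.arcs.length) : localWeight (Θ (γ.fc i).1) (γ.kindsIn (γ.fc i)) ≠ 0 := by
  have hmem : γ.fc i ∈ γ.facesVisited := γ.mem_facesVisited_of_arcFace (arcAt_mem hi) (arcFace_arcAt hi).1
  rw [weight] at hw
  exact (Finset.prod_ne_zero_iff.1 hw) _ hmem


/-- `nth` is injective on the indices of the walk (the mid-edges are distinct). [cite: GlazmanManolescu2019, §1 (self-avoiding walks)] -/
theorem nth_inj_of_le (γ : YBWalk D a z) {k l : ℕ} (hk : k ≤ γ.arcs.length) (hl : l ≤ γ.arcs.length)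
    (e : γ.nth k = γ.nth l) : k = l := by
  have h0 := γ.length_pos
  have hn := γ.length_arcs
  have h1 : k < γ.mids.length := by omega
  have h2 : l < γ.mids.length := by omega
  rw [γ.nth_eq_getElem h1, γ.nth_eq_getElem h2] at e
  exact (List.Nodup.getElem_inj_iff γ.nodup).1 e

/-- The two sides of the `i`-th arc are the `i`-th and `(i+1)`-st mid-edges. [cite: GlazmanManolescu2019, §1 (an arc joins two sides of one rhombus)] -/
theorem side_sIn_eq_nth (γ : YBWalk D a z) {i : ℕ} (hi : i < γ.arcs.length) :
    (γ.fc i).side (γ.sIn i) = γ.nth i ∧ (γ.fc i).side (γ.sOut i) = γ.nth (i + 1) := by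
  obtain ⟨h1, h2, -⟩ := side_sIn hi
  rw [← γ.nth_eq_getElem] at h1 h2
  exact ⟨h1, h2⟩

/-- ★ **TWO ARCS IN ONE RHOMBUS USE ALL FOUR OF ITS SIDES**: a walk ending on a side of `f`, arriving from outside
(`f` is not its last rhombus), cannot have drawn two arcs in `f` — the final mid-edge would be a fifth side of `f`.
In particular a walk with two `θ`-corner arcs in `f` never returns to `∂f`. [cite: GlazmanManolescu2019, §1 (Fig. 1: the arc configurations of a rhombus)]
[cite: Glazman2015WeightedSAW, Lemma 3.1 (proof, pp. 6–7: the classes of walks through a rhombus)] -/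
theorem not_two_arcs_of_last_ne {f : Face} {t : Side} (γ : YBWalk D a (f.side t))
    (hlast : γ.fc (γ.arcs.length - 1) ≠ f) {i j : ℕ} (hij : i < j) (hj : j < γ.arcs.length)
    (hfi : γ.fc i = f) (hfj : γ.fc j = f) : False := by
  have hi : i < γ.arcs.length := lt_trans hij hj
  have hjn : j + 1 < γ.arcs.length := by
    rcases Nat.lt_or_ge (j + 1) γ.arcs.length with h | h
    · exact h
    · exact absurd (by rw [show γ.arcs.length - 1 = j by omega, hfj]) hlast
  have hi1 : i + 1 < j := by
    rcases Nat.lt_or_ge (i + 1) j with h | h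
    · exact h
    · exfalso
      have e : i + 1 = j := by omega
      have := fc_succ_ne (γ := γ) (i := i) (by omega)
      rw [e, hfi, hfj] at this
      exact this rfl
  obtain ⟨eIi, eOi⟩ := γ.side_sIn_eq_nth hi
  obtain ⟨eIj, eOj⟩ := γ.side_sIn_eq_nth hj
  rw [hfi] at eIi eOi
  rw [hfj] at eIj eOj
  have et : f.side t = γ.nth γ.arcs.length := γ.nth_length.symm
  -- distinct indices carry distinct mid-edges, hence distinct sides of `f`
  have hdist : ∀ {k l : ℕ} {s u : Side}, k ≤ γ.arcs.length → l ≤ γ.arcs.length → k ≠ l →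
      f.side s = γ.nth k → f.side u = γ.nth l → s ≠ u := by
    intro k l s u hk hl hkl hs hu hsu
    subst hsu
    exact hkl (γ.nth_inj_of_le hk hl (hs.symm.trans hu))
  have d1 := hdist (s := γ.sIn i) (u := γ.sOut i) hi.le (by omega) (by omega) eIi eOi
  have d2 := hdist (s := γ.sIn i) (u := γ.sIn j) hi.le hj.le (by omega) eIi eIj
  have d3 := hdist (s := γ.sIn i) (u := γ.sOut j) hi.le (by omega) (by omega) eIi eOj
  have d4 := hdist (s := γ.sOut i) (u := γ.sIn j) (by omega) hj.le (by omega) eOi eIj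
  have d5 := hdist (s := γ.sOut i) (u := γ.sOut j) (by omega) (by omega) (by omega) eOi eOj
  have d6 := hdist (s := γ.sIn j) (u := γ.sOut j) hj.le (by omega) (by omega) eIj eOj
  have t1 := hdist (s := t) (u := γ.sIn i) le_rfl hi.le (by omega) et eIi
  have t2 := hdist (s := t) (u := γ.sOut i) le_rfl (by omega) (by omega) et eOi
  have t3 := hdist (s := t) (u := γ.sIn j) le_rfl hj.le (by omega) et eIj
  have t4 := hdist (s := t) (u := γ.sOut j) le_rfl (by omega) (by omega) et eOj
  -- five pairwise distinct sides of a rhombus: impossible (a rhombus has four sides)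
  have hle := Finset.card_le_univ ({γ.sIn i, γ.sOut i, γ.sIn j, γ.sOut j, t} : Finset Side)
  rw [Finset.card_insert_of_notMem (by simp [d1, d2, d3, Ne.symm t1]),
    Finset.card_insert_of_notMem (by simp [d4, d5, Ne.symm t2]),
    Finset.card_insert_of_notMem (by simp [d6, Ne.symm t3]),
    Finset.card_insert_of_notMem (by simp [Ne.symm t4]), Finset.card_singleton,
    show Fintype.card Side = 4 from rfl] at hle
  omega

end YBWalk

namespace ΩG
open YBWalk HV
open private returnHit_leG nth_returnHitG returnHit_memG firstHit_le_of_memG arcFace_firstHitG fc_fh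
  from Literature.Probability.RandomPlanarGeometry.YangBaxterSAWGeneralDomain
open private eq_faces_of_side_eq from Literature.Probability.RandomPlanarGeometry.YangBaxterSAWExcursionJordan

variable {D : Set Face} {a : MidEdge} {r : Face} {ω : ΩG D a r}

/-- **A criterion for the returning class.** A walk to `∂r` that continues after its first arc in `r` and draws
no further arc in `r` is of class `B2a`: its return to `∂r` is its end (a return before the end would be followed
by an arc of `r`, the arriving arc being outside `r`). [cite: Glazman2015WeightedSAW, Lemma 3.1 (proof, pp. 6–7: the classes of walks through a rhombus)]
[cite: GlazmanManolescu2019, Lemma 2.1] -/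
theorem isB2a_of_forall_fc_ne (hB2 : ω.2.firstHitG + 1 < ω.2.arcs.length)
    (hno : ∀ j, ω.2.firstHitG < j → j < ω.2.arcs.length → ω.2.fc j ≠ r) : ω.IsB2a := by
  refine ⟨hB2, ?_⟩
  have hRle := returnHit_leG ω.2 hB2
  obtain ⟨-, hRgt⟩ := returnHit_memG ω.2 hB2
  by_contra hne
  have hRlt : ω.2.returnHitG hB2 < ω.2.arcs.length := lt_of_le_of_ne hRle hne
  set R := ω.2.returnHitG hB2 with hRdef
  have hs := nth_returnHitG ω.2 hB2
  have h1 := (YBWalk.side_sIn (γ := ω.2) (i := R - 1) (by omega)).2.1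
  have h2 := (YBWalk.side_sIn (γ := ω.2) (i := R) hRlt).1
  rw [← ω.2.nth_eq_getElem, show R - 1 + 1 = R by omega, hs] at h1
  rw [← ω.2.nth_eq_getElem, hs] at h2
  have hne' : ω.2.fc (R - 1) ≠ ω.2.fc R := by
    have := YBWalk.fc_succ_ne (γ := ω.2) (i := R - 1) (by omega)
    rwa [show R - 1 + 1 = R by omega] at this
  have hf1 := hno (R - 1) (by omega) (by omega)
  have hf2 := hno R (by omega) hRlt
  rcases eq_faces_of_side_eq h1 with e1 | e1 <;>
    rcases eq_faces_of_side_eq h2 with e2 | e2 <;>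
    rcases eq_faces_of_side_eq (rfl : r.side (ω.2.returnSideG hB2) = _) with e3 | e3
  all_goals first | exact hne' (e1.trans e2.symm) | exact hf1 (e1.trans e3.symm) | exact hf2 (e2.trans e3.symm)

/-- ★★ **A NON-`θ`-CORNER ARC IN `f` AND A LAST ARC OUTSIDE `f` MAKE A WOUND-TYPE RETURNING WALK.** A walk of
non-zero `π/3`-weight from a non-interior root to a side of `f`, with an arc in `f` that crosses both triangles and
whose last arc is not in `f`, is of class `B2a` at `f`, its arc in `f` being that arc (a second arc in `f` would have
to be a `θ`-corner arc together with the first, `w₂(π/3) = 0`). [cite: Glazman2015WeightedSAW, Lemma 3.1 (proof, pp. 6–7)]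
[cite: GlazmanManolescu2019, §1 («if θ = π/3, then w₂ = 0»), Lemma 2.1] -/
theorem exists_isB2a_of_nonCorner_arc (hr : RootedFace D a r) (hw : ω.2.weight (fun _ => π / 3) ≠ 0)
    (hlast : ω.2.fc (ω.2.arcs.length - 1) ≠ r) {i : ℕ} (hi : i < ω.2.arcs.length) (hfi : ω.2.fc i = r)
    (htri : (ω.2.sIn i).tri ≠ (ω.2.sOut i).tri) :
    ∃ h : ω.IsB2a, ω.2.firstHitG = i ∧ arcKind ω.2.firstSideG (ω.z1 hr h) ≠ .corner := by
  -- the first hit is at most `i`, and its arc lies in `r`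
  have hmem : i ∈ ω.2.hitIdx r := (mem_hitIdx_of_arcFace hi (by rw [ω.2.arcFace_nth_eq_fc hi, hfi])).1
  have hFi : ω.2.firstHitG ≤ i := firstHit_le_of_memG ω.2 hmem
  have hF : ω.2.firstHitG < ω.2.arcs.length := by omega
  have hfcF : ω.2.fc ω.2.firstHitG = r := by
    have h1 := arcFace_firstHitG ω.2 hr hF
    rw [ω.2.arcFace_nth_eq_fc hF, Option.some.injEq] at h1
    exact h1
  -- no other arc lies in `r`: it would make arc `i` a corner arc
  have honly : ∀ j, j < ω.2.arcs.length → ω.2.fc j = r → j = i := by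
    intro j hj hfj
    by_contra hji
    exact htri (tri_eq_of_weight_ne_zero hw hi hj (Ne.symm hji) (hfj.trans hfi.symm))
  have hFeq : ω.2.firstHitG = i := honly _ hF hfcF
  have hin : i ≠ ω.2.arcs.length - 1 := fun e => hlast (by rw [← e, hfi])
  have hB2 : ω.2.firstHitG + 1 < ω.2.arcs.length := by omega
  have h : ω.IsB2a := isB2a_of_forall_fc_ne hB2 fun j hj1 hj2 hfj => by
    have := honly j hj2 hfj; omega
  refine ⟨h, hFeq, fun hc => htri ?_⟩
  obtain ⟨-, hsIn, hsOut⟩ := fc_fh ω hr h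
  have hst : ω.2.firstSideG ≠ ω.z1 hr h := by
    rw [← hsIn, ← show ω.2.sOut ω.2.firstHitG = ω.z1 hr h from hsOut]
    exact (YBWalk.side_sIn hF).2.2
  have e := (arcKind_eq_corner_iff hst).1 hc
  rw [← hsIn, ← show ω.2.sOut ω.2.firstHitG = ω.z1 hr h from hsOut, hFeq] at e
  exact e

end ΩG

/-! ### The pull-back of an encircling-type loop-class walk -/

namespace ΩG
open YBWalk HV

variable {Dl : List Face} {f : Face}

/-- ★★ **EVERY LOOP-CLASS HONEYCOMB WALK AT A TRIANGLE OF `f` WHOSE FINAL HALF-EDGE CROSSES A RHOMBUS SIDE IS THE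
HONEYCOMB WALK OF A YANG–BAXTER WALK TO `∂f`**, of non-zero `π/3`-weight, arriving at `f` from outside, `f` having
been crossed before (∘ the dictionary's surjectivity §9 and weight criterion §10). [cite: GlazmanManolescu2019, §1 (Fig. 2)]
[cite: DuminilCopinSmirnov2012, proof of Lemma 1 (the walks visiting all three mid-edges of a vertex)] -/
theorem exists_hvWalk_eq_of_mem_clsLoop (hD : ((-1 : ℤ), (0 : ℤ)) ∉ Dl) {σ : Side} {P : List HV}
    (hP : P ∈ clsLoop (triSet Dl.toFinset) (f.hv σ))
    (hE : (edgeOf (HV.finalDart P).1 (HV.finalDart P).2).isSome) :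
    ∃ (t : Side) (γ : YBWalk (PlaquetteWalk.dom Dl) origin (f.side t)),
      γ.hvWalk = P ∧ t.tri = σ.tri ∧ γ.weight (fun _ => π / 3) ≠ 0 ∧ 0 < γ.arcs.length ∧
        γ.fc (γ.arcs.length - 1) ≠ f ∧ ∃ k < γ.arcs.length, γ.fc k = f ∧ (γ.fc k).hv σ ∈ γ.arcHV k := by
  have hD' : ((-1 : ℤ), (0 : ℤ)) ∉ PlaquetteWalk.dom Dl := hD
  have hDF : ∀ g, g ∈ PlaquetteWalk.dom Dl ↔ g ∈ Dl.toFinset := fun g => by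
    rw [List.mem_toFinset]; rfl
  rw [HV.clsLoop, Finset.mem_filter] at hP
  obtain ⟨hPm, hlast, hinner⟩ := hP
  have hPw := HV.mem_midWalks_iff.1 hPm
  obtain ⟨z, γ, hγ⟩ := YBWalk.exists_hvWalk_eq (PlaquetteWalk.dom Dl) Dl.toFinset hDF hD' P.length P rfl hPw hE
  have hn : 0 < γ.arcs.length := by
    by_contra h0
    rw [γ.hvWalk_of_origin_trivial hD' (by omega)] at hγ
    rw [← hγ] at hinner
    simp [HV.inner] at hinner
  have hw : γ.weight (fun _ => π / 3) ≠ 0 := by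
    rw [YBWalk.weight_pi_div_three_ne_zero_iff_nodup, ← γ.inner_hvWalk_of_origin hD', hγ]
    exact hPw.2.2.2.2.1
  have hfd := γ.finalDart_hvWalk_of_origin hD' hn
  rw [hγ] at hfd
  have hout : (γ.fc (γ.arcs.length - 1)).hvAcross (γ.sOut (γ.arcs.length - 1)) = f.hv σ := by
    have e := congrArg Prod.snd hfd
    rw [hlast] at e
    exact e.symm
  obtain ⟨t, ht, htri⟩ := exists_side_of_hvAcross_eq_hv hout
  have hz : z = f.side t := by rw [← YBWalk.side_sOut_lastG hn, ht]
  subst hz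
  have hch : γ.fc (γ.arcs.length - 1) ≠ f := by
    intro e; rw [e] at hout; exact Face.hvAcross_ne_hv f _ _ hout
  -- `f` was crossed before: its triangle `f.hv σ` is an inner vertex
  rw [← hγ, γ.inner_hvWalk_of_origin hD'] at hinner
  obtain ⟨k, hk, hmem⟩ := (mem_hvUpTo_iff (γ := γ)).1 hinner
  obtain ⟨s', he⟩ | ⟨s', he⟩ : (∃ s', f.hv σ = (γ.fc k).hv s') ∨ (∃ s', f.hv σ = (γ.fc k).hv s') := by
    rcases (mem_arcHV_iff (γ := γ)).1 hmem with h | h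
    · exact Or.inl ⟨_, h⟩
    · exact Or.inl ⟨_, h⟩
  all_goals
    have hfk : γ.fc k = f := ((Face.hv_eq_hv_iff.1 he).1).symm
    exact ⟨t, γ, hγ, htri, hw, hn, hch, k, hk, hfk, by rw [hfk]; exact hmem⟩

/-- ★★★ **THE CONVERSE DICTIONARY: EVERY ENCIRCLING-TYPE LOOP-CLASS WALK IS THE HONEYCOMB WALK OF A NON-`θ`-CORNER
RETURNING YANG–BAXTER WALK, AND IT ENCIRCLES THE ROOT FACE IFF THAT WALK IS WOUND.** For `Dl ∌ (−1, 0)` and a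
loop-class walk `P` of the triangle domain at a triangle `f.hv σ` whose final half-edge crosses a rhombus side: `P` is
the honeycomb walk of a Yang–Baxter walk `ω` from the origin to a side of `f` on that triangle, of non-zero `π/3`-weight,
of class `B2a` at `f` with a NON-`θ`-corner arc in `f` — and the loop of `P` winds about the root face iff the excursion
polygon of `ω` winds about the root. (One arc in `f` only: a single `θ`-corner arc would force the return through a side
already crossed, two arcs use all four sides of `f` — `YBWalk.not_two_arcs_of_last_ne`; with edition 1's
`hvWalk_mem_encircling_iff_AJ_root_ne_zero` this makes `ω ↦ ω.2.hvWalk` a bijection between the wound non-`θ`-corner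
class-`B2a` walks at `f` of non-zero weight and the encircling loop-class walks at the triangles of `f` ending across a
rhombus side.) [cite: GlazmanManolescu2019, §1 (θ = π/3; «w₂ = 0 and v = w₁ = u₂ = u₁²»), Lemma 2.1]
[cite: DuminilCopinSmirnov2012, proof of Lemma 1] [cite: Glazman2015WeightedSAW, Lemma 3.1 (proof, pp. 6–7)] -/
theorem exists_isB2a_of_mem_clsLoop (hD : ((-1 : ℤ), (0 : ℤ)) ∉ Dl) {σ : Side} {P : List HV}
    (hP : P ∈ clsLoop (triSet Dl.toFinset) (f.hv σ))
    (hE : (edgeOf (HV.finalDart P).1 (HV.finalDart P).2).isSome) :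
    ∃ (ω : ΩG (PlaquetteWalk.dom Dl) origin f) (hr : RootedFace (PlaquetteWalk.dom Dl) origin f) (h : ω.IsB2a),
      ω.2.hvWalk = P ∧ (ω.1).tri = σ.tri ∧ ω.2.weight (fun _ => π / 3) ≠ 0 ∧
      arcKind ω.2.firstSideG (ω.z1 hr h) ≠ .corner ∧
      (HV.loopWnd (f.hv σ) P ≠ 0 ↔ ω.AJ hr h (toC (midPt origin)) ≠ 0) := by
  obtain ⟨t, γ, hγ, htri, hw, hn, hch, k, hk, hfk, hkmem⟩ := exists_hvWalk_eq_of_mem_clsLoop (f := f) hD hP hE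
  have hD' : ((-1 : ℤ), (0 : ℤ)) ∉ PlaquetteWalk.dom Dl := hD
  have hr : RootedFace (PlaquetteWalk.dom Dl) origin f :=
    ⟨by rw [← hfk]; exact (arcFace_arcAt hk).2, fun h => hD' (by simpa [origin, MidEdge.faces] using h.1)⟩
  set ω : ΩG (PlaquetteWalk.dom Dl) origin f := ⟨t, γ⟩ with hω
  -- arc `k` is the only arc in `f`, hence it crosses both triangles
  have htri' : (γ.sIn k).tri ≠ (γ.sOut k).tri := by
    intro heq
    -- a one-triangle arc: the return triangle `f.hv σ` is that triangle, so the final side is a side of arc `k`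
    have hσ : σ.tri = (γ.sIn k).tri := by
      have hm := hkmem
      unfold YBWalk.arcHV at hm
      rw [if_pos heq, List.mem_singleton, hfk] at hm
      exact ((Face.hv_eq_hv_iff.1 hm).2)
    have hst := (YBWalk.side_sIn hk).2.2
    obtain ⟨eI, eO⟩ := γ.side_sIn_eq_nth hk
    rw [hfk] at eI eO
    have et : f.side t = γ.nth γ.arcs.length := γ.nth_length.symm
    have hk1 : k + 1 < γ.arcs.length := by
      rcases Nat.lt_or_ge (k + 1) γ.arcs.length with h | h
      · exact h
      · exact absurd (by rw [show γ.arcs.length - 1 = k by omega, hfk]) hch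
    rcases Side.eq_or_eq_of_tri_eq (htri.trans hσ) heq hst with e | e
    · have e' : f.side t = γ.nth k := by rw [← e] at eI; exact eI
      have := γ.nth_inj_of_le le_rfl hk.le (et.symm.trans e')
      omega
    · have e' : f.side t = γ.nth (k + 1) := by rw [← e] at eO; exact eO
      have := γ.nth_inj_of_le le_rfl (by omega) (et.symm.trans e')
      omega
  obtain ⟨h, -, hnc⟩ := exists_isB2a_of_nonCorner_arc (ω := ω) hr hw hch hk hfk htri'
  refine ⟨ω, hr, h, hγ, htri, hw, hnc, ?_⟩
  have e := loopWnd_hvWalk_ne_zero_iff_AJ_root_ne_zero (ω := ω) (hr := hr) hD h hnc hw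
  have hv : f.hv ω.1 = f.hv σ := Face.hv_eq_hv_iff.2 ⟨rfl, htri⟩
  rw [hv, hγ] at e
  exact e

end ΩG

end Converse


/-! ## §6. The two rays behind the two ends of the root edge are crossed with equal parity (edition 3) -/

section TwoRays

/-- The cells of the half-strip behind the `W` side of `b` (`ExcursionJordan`'s `rayCell b W ·`): row `b.2`, columns `≤ b.1 − 1`.
[folklore] [cite: CourantRobbins1958, Ch. V Appendix §2 (the even–odd rule: a ray of the lattice)] -/
theorem exists_eq_rayCell_W_iff (g b : Face) : (∃ k : ℕ, g = rayCell b .W k) ↔ g.2 = b.2 ∧ g.1 + 1 ≤ b.1 := by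
  obtain ⟨k₁, j₁⟩ := g
  obtain ⟨b₁, b₂⟩ := b
  constructor
  · rintro ⟨k, hk⟩
    simp only [rayCell, Prod.mk.injEq] at hk
    omega
  · rintro ⟨h1, h2⟩
    refine ⟨(b₁ - 1 - k₁).toNat, ?_⟩
    simp only [rayCell, Prod.mk.injEq]
    omega

/-- The ray behind the `W` side of `b`: the `S` sides of the half-strip cells, i.e. the `S` side of `(k, b.2)` or the `N` side of
`(k, b.2 − 1)`, `k ≤ b.1 − 1`. [folklore] [cite: CourantRobbins1958, Ch. V Appendix §2 (the even–odd rule)] -/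
theorem exists_side_eq_rayMid_W_iff (g b : Face) (s : Side) :
    (∃ m : ℕ, g.side s = rayMid b .W m) ↔
      (s = .S ∧ g.2 = b.2 ∧ g.1 + 1 ≤ b.1) ∨ (s = .N ∧ g.2 + 1 = b.2 ∧ g.1 + 1 ≤ b.1) := by
  obtain ⟨k₁, j₁⟩ := g
  obtain ⟨b₁, b₂⟩ := b
  constructor
  · rintro ⟨m, hm⟩
    cases s <;> simp [Face.side, rayMid, rayCell, raySide] at hm ⊢ <;> omega
  · rintro (⟨rfl, h2, h1⟩ | ⟨rfl, h2, h1⟩)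
    · refine ⟨(b₁ - 1 - k₁).toNat, ?_⟩
      simp only [Face.side, rayMid, rayCell, raySide, MidEdge.slant.injEq]
      omega
    · refine ⟨(b₁ - 1 - k₁).toNat, ?_⟩
      simp only [Face.side, rayMid, rayCell, raySide, MidEdge.slant.injEq]
      omega

/-- **The boundary of the half-strip behind a `W` side.** Two distinct rhombi with a common side: exactly one of them is a
cell of the half-strip behind `b.side W` iff the common side lies on the ray behind `b.side W`, on the PARALLEL ray behind the
`W` side of the rhombus `(b.1, b.2 + 1)` above `b` (the ray from the OTHER end of `b.side W`), or is `b.side W` itself.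
[folklore] [cite: CourantRobbins1958, Ch. V Appendix §2 (the even–odd rule)] -/
theorem xor_rayCell_W_iff {g g' : Face} {s s' : Side} (b : Face) (he : g.side s = g'.side s') (hgg' : g ≠ g') :
    ((∃ k : ℕ, g = rayCell b .W k) ↔ ¬(∃ k : ℕ, g' = rayCell b .W k)) ↔
      ((∃ m : ℕ, g.side s = rayMid b .W m) ∨ (∃ m : ℕ, g.side s = rayMid (b.1, b.2 + 1) .W m) ∨ g.side s = b.side .W) := by
  rw [exists_eq_rayCell_W_iff, exists_eq_rayCell_W_iff, exists_side_eq_rayMid_W_iff, exists_side_eq_rayMid_W_iff]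
  obtain ⟨k₁, j₁⟩ := g
  obtain ⟨k₂, j₂⟩ := g'
  obtain ⟨b₁, b₂⟩ := b
  rcases side_eq_side_cases he hgg' with ⟨rfl, rfl, e⟩ | ⟨rfl, rfl, e⟩ | ⟨rfl, rfl, e⟩ | ⟨rfl, rfl, e⟩ <;>
    simp only [Prod.mk.injEq, Face.side, MidEdge.vert.injEq, reduceCtorEq, false_and, false_or, or_false,
      true_and] at e ⊢ <;> omega


/-- **Telescoping parity around a cycle**: along a cyclic sequence, the number of positions where a property CHANGES between
consecutive terms is even. [folklore] [cite: CourantRobbins1958, Ch. V Appendix §2 (the even–odd rule)] -/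
theorem even_card_filter_iff_not_succ_mod {M : ℕ} (hM : 0 < M) (χ : ℕ → Prop) [DecidablePred χ] :
    Even (((Finset.range M).filter fun j => (χ j ↔ ¬χ ((j + 1) % M))).card) := by
  rw [← ZMod.natCast_eq_zero_iff_even, Finset.natCast_card_filter]
  have key : ∀ j, (if (χ j ↔ ¬χ ((j + 1) % M)) then (1 : ZMod 2) else 0) =
      (if χ j then 1 else 0) + (if χ ((j + 1) % M) then 1 else 0) := by
    intro j
    by_cases h1 : χ j
    · by_cases h2 : χ ((j + 1) % M)
      · simp only [h1, h2, not_true_eq_false, iff_false, if_false, if_true]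
        decide
      · simp [h1, h2]
    · by_cases h2 : χ ((j + 1) % M)
      · simp [h1, h2]
      · simp [h1, h2]
  rw [Finset.sum_congr rfl fun j _ => key j, Finset.sum_add_distrib]
  have rot : ∑ j ∈ Finset.range M, (if χ ((j + 1) % M) then (1 : ZMod 2) else 0) =
      ∑ j ∈ Finset.range M, (if χ j then (1 : ZMod 2) else 0) := by
    obtain ⟨M', rfl⟩ : ∃ M', M = M' + 1 := ⟨M - 1, by omega⟩
    rw [Finset.sum_range_succ, Finset.sum_range_succ' (fun j => if χ j then (1 : ZMod 2) else 0), Nat.mod_self]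
    congr 1
    refine Finset.sum_congr rfl fun j hj => ?_
    rw [Finset.mem_range] at hj
    rw [Nat.mod_eq_of_lt (by omega)]
  rw [rot, ← two_mul, show (2 : ZMod 2) = 0 from rfl, zero_mul]

namespace ΩG

open YBWalk
open private side_jOut_eq_side_jIn_succ from Literature.Probability.RandomPlanarGeometry.YangBaxterSAWExcursionJordan

variable {D : Set Face} {a : MidEdge} {r : Face} {ω : ΩG D a r} {hr : RootedFace D a r}

open scoped Classical in
/-- ★★ **THE TWO RAYS BEHIND A `W` SIDE ARE CROSSED WITH EQUAL PARITY.** For a walk of class `B2a` at `r` and a rhombus `b`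
whose `W` side the excursion polygon `J` does not cross: the number of crossings of the ray behind `b.side W` (from its lower
end) plus the number of crossings of the parallel ray from its upper end (the ray behind the `W` side of `(b.1, b.2 + 1)`) is
EVEN — `J` enters and leaves the half-strip between the two rays equally often. (No Jordan curve theorem: consecutive slots of
`J` lie in the two rhombi of their common mid-edge, and the membership of the slot rhombus in the half-strip changes an even
number of times around the cycle.) [cite: CourantRobbins1958, Ch. V Appendix §2 (The Jordan Curve Theorem for Polygons: the even–odd rule)]
[cite: Glazman2015WeightedSAW, Lemma 3.1 (proof, pp. 6–7: the classes of walks through a rhombus)] -/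
theorem even_rayCountAt_add_rayCountAt_north (h : ω.IsB2a) {b : Face}
    (hb : ∀ j < ω.Mv, (ω.jFace h j).side (ω.jOut hr h j) ≠ b.side .W) :
    Even (ω.rayCountAt hr h b .W + ω.rayCountAt hr h (b.1, b.2 + 1) .W) := by
  have hM : 3 ≤ ω.Mv := three_le_Mv hr h
  unfold rayCountAt
  rw [← Finset.card_union_of_disjoint]
  · -- the union is the set of slots whose exit mid-edge lies on the boundary of the half-strip
    have hset : ((Finset.range ω.Mv).filter fun j => ∃ m : ℕ, (ω.jFace h j).side (ω.jOut hr h j) = rayMid b .W m) ∪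
        ((Finset.range ω.Mv).filter fun j => ∃ m : ℕ, (ω.jFace h j).side (ω.jOut hr h j) = rayMid (b.1, b.2 + 1) .W m) =
        (Finset.range ω.Mv).filter fun j =>
          ((∃ k : ℕ, ω.jFace h j = rayCell b .W k) ↔ ¬(∃ k : ℕ, ω.jFace h ((j + 1) % ω.Mv) = rayCell b .W k)) := by
      rw [← Finset.filter_or]
      refine Finset.filter_congr fun j hj => ?_
      rw [Finset.mem_range] at hj
      obtain ⟨hside, hne'⟩ := side_jOut_eq_side_jIn_succ (hr := hr) h hj
      rw [xor_rayCell_W_iff b hside.symm hne'.symm]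
      rw [← or_assoc, or_iff_left (hb j hj)]
    rw [hset]
    exact even_card_filter_iff_not_succ_mod (by omega) _
  · rw [Finset.disjoint_filter]
    rintro j - ⟨m, hm⟩ ⟨m', hm'⟩
    rw [hm] at hm'
    obtain ⟨b₁, b₂⟩ := b
    simp [rayMid, rayCell, raySide, Face.side] at hm'

/-- ★★★ **WOUND ⟺ ODD CROSSINGS OF THE RAY FROM THE OTHER END OF THE ROOT.** For a walk of class `B2a` at `r` and the root
presented as `a = b.side W`: the excursion polygon winds about the midpoint of the root iff it crosses the ray from the UPPER
end of the root edge (behind the `W` side of `(b.1, b.2 + 1)`) an odd number of times — the tree's parity law for the lower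
ray, carried across the root edge. (For the venture lane: at `θ = 2π/3` the reflection in the row of the root exchanges the two
rays, so this is the crossing count that the REFLECTED triangulation's loop winding number reads.)
[cite: CourantRobbins1958, Ch. V Appendix §2 (the even–odd rule)] [cite: Glazman2015WeightedSAW, Lemma 3.1 (proof, pp. 6–7)]
[cite: DuminilCopinSmirnov2012, proof of Lemma 1 («we used the fact that a is on the boundary and Ω is simply connected»)] -/
theorem AJ_root_ne_zero_iff_odd_rayCountAt_north (h : ω.IsB2a) {b : Face} (hab : b.side .W = a) :
    ω.AJ hr h (toC (midPt a)) ≠ 0 ↔ Odd (ω.rayCountAt hr h (b.1, b.2 + 1) .W) := by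
  rw [AJ_root_ne_zero_iff_odd_rayCountAt h hab]
  have hev := even_rayCountAt_add_rayCountAt_north (hr := hr) h (b := b)
    fun j hj e => exit_ne_root (hr := hr) h hj (e.trans hab)
  rw [Nat.even_add] at hev
  rw [← Nat.not_even_iff_odd, ← Nat.not_even_iff_odd, hev]

/-- ★★ **ENCIRCLING ⟺ ODD NORTH-RAY CROSSINGS** (root at the origin): for a walk of class `B2a` at `f` from the origin with
non-zero `π/3`-weight and a non-`θ`-corner arc in `f`, the loop of its honeycomb walk winds about the root face iff the
excursion polygon crosses the ray from the NORTH-west corner of the origin rhombus (behind the `W` side of `(0, 1)`) an odd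
number of times — edition 1's criterion, read on the other ray. [cite: DuminilCopinSmirnov2012, proof of Lemma 1]
[cite: CourantRobbins1958, Ch. V Appendix §2 (the even–odd rule)] [cite: Glazman2015WeightedSAW, Lemma 3.1 (proof, pp. 6–7)] -/
theorem loopWnd_hvWalk_ne_zero_iff_odd_rayCountAt_north {Dl : List Face} {f : Face}
    {ω : ΩG (PlaquetteWalk.dom Dl) origin f} {hr : RootedFace (PlaquetteWalk.dom Dl) origin f}
    (hD : ((-1 : ℤ), (0 : ℤ)) ∉ Dl) (h : ω.IsB2a)
    (hκ : arcKind ω.2.firstSideG (ω.z1 hr h) ≠ .corner) (hw : ω.2.weight (fun _ => π / 3) ≠ 0) :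
    HV.loopWnd (f.hv ω.1) ω.2.hvWalk ≠ 0 ↔ Odd (ω.rayCountAt hr h ((0 : ℤ), (1 : ℤ)) .W) := by
  rw [loopWnd_hvWalk_ne_zero_iff_AJ_root_ne_zero hD h hκ hw,
    AJ_root_ne_zero_iff_odd_rayCountAt_north (hr := hr) h (b := ((0 : ℤ), (0 : ℤ))) rfl]
  rfl

end ΩG

end TwoRays


/-! ## §7. The second triangulation (edition 4): the class-`B2a` anatomy under the row reflection, and encircling in the
reflected honeycomb lattice ⟺ wound -/

section SecondTriangulation

open Literature.Barriers.CriticalPhenomena.PlaquetteWalk (mirrorRow mirrorRowFace mirrorSide mirrorKind mirrorRow_side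
  mirrorRow_injective mirrorRowFace_injective commonFace_mirrorRow arcKind_mirrorSide mirrorRow_mirrorRow mirrorRowFace_mirrorRowFace
  mirrorSide_mirrorSide)

/-- A side of the reflected rhombus is the reflection of the mirror side. [cite: GlazmanManolescu2019, §1, Fig. 4] -/
theorem side_mirrorRowFace (c : ℤ) (f : Face) (s : Side) :
    (mirrorRowFace c f).side s = mirrorRow c (f.side (mirrorSide s)) := by
  rw [mirrorRow_side, mirrorSide_mirrorSide]

/-- The reflection of row `c` carries the ray behind the `W` side of `b` to the ray behind the `W` side of the rhombus
ABOVE the reflected rhombus (the lower edge of a row goes to the upper edge of the reflected row). [folklore]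
[cite: CourantRobbins1958, Ch. V Appendix §2 (the even–odd rule: a ray of the lattice)] -/
theorem mirrorRow_rayMid_W (c : ℤ) (b : Face) (m : ℕ) :
    mirrorRow c (rayMid b .W m) = rayMid ((b.1 : ℤ), (2 * c - b.2 + 1 : ℤ)) .W m := by
  obtain ⟨b₁, b₂⟩ := b
  simp only [rayMid, rayCell, raySide, Face.side, mirrorRow, MidEdge.slant.injEq, true_and]
  ring

namespace YBWalk

section MirrorMids

variable {D D' : Set Face} {a z a' z' : MidEdge} {c : ℤ} {γ : YBWalk D a z} {δ : YBWalk D' a' z'}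

/-- A walk whose mid-edges are the reflected mid-edges starts at the reflected start. [cite: GlazmanManolescu2019, §4.2 (lattice symmetries)] -/
theorem start_eq_of_mids_mirror (hm : δ.mids = γ.mids.map (mirrorRow c)) : a' = mirrorRow c a := by
  have h1 := δ.head_eq
  rw [hm, List.head?_map, γ.head_eq, Option.map_some, Option.some.injEq] at h1
  exact h1.symm

/-- … and has as many arcs. [cite: GlazmanManolescu2019, §4.2 (lattice symmetries)] -/
theorem length_arcs_eq_of_mids_mirror (hm : δ.mids = γ.mids.map (mirrorRow c)) : δ.arcs.length = γ.arcs.length := by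
  rw [δ.length_arcs, γ.length_arcs, hm, List.length_map]

/-- … and its `i`-th mid-edge is the reflected one. [cite: GlazmanManolescu2019, §4.2 (lattice symmetries)] -/
theorem nth_eq_of_mids_mirror (hm : δ.mids = γ.mids.map (mirrorRow c)) (i : ℕ) : δ.nth i = mirrorRow c (γ.nth i) := by
  unfold nth
  rw [hm, start_eq_of_mids_mirror hm, List.getD_map]

/-- … and its `i`-th arc lies in the reflected rhombus. [cite: GlazmanManolescu2019, §4.2 (lattice symmetries)] -/
theorem fc_eq_of_mids_mirror (hm : δ.mids = γ.mids.map (mirrorRow c)) {i : ℕ} (hi : i < γ.arcs.length) :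
    δ.fc i = mirrorRowFace c (γ.fc i) := by
  have hi' : i < δ.arcs.length := by rwa [length_arcs_eq_of_mids_mirror hm]
  have h1 := δ.arcFace_nth_eq_fc hi'
  rw [nth_eq_of_mids_mirror hm, nth_eq_of_mids_mirror hm] at h1
  have key : arcFace (mirrorRow c (γ.nth i), mirrorRow c (γ.nth (i + 1))) =
      (arcFace (γ.nth i, γ.nth (i + 1))).map (mirrorRowFace c) := commonFace_mirrorRow c _ _
  rw [key, γ.arcFace_nth_eq_fc hi, Option.map_some, Option.some.injEq] at h1
  exact h1.symm

/-- … through the reflected sides. [cite: GlazmanManolescu2019, §4.2 (lattice symmetries)] -/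
theorem sIn_sOut_eq_of_mids_mirror (hm : δ.mids = γ.mids.map (mirrorRow c)) {i : ℕ} (hi : i < γ.arcs.length) :
    δ.sIn i = mirrorSide (γ.sIn i) ∧ δ.sOut i = mirrorSide (γ.sOut i) := by
  have hi' : i < δ.arcs.length := by rwa [length_arcs_eq_of_mids_mirror hm]
  obtain ⟨e1, e2⟩ := δ.side_sIn_eq_nth hi'
  obtain ⟨f1, f2⟩ := γ.side_sIn_eq_nth hi
  rw [fc_eq_of_mids_mirror hm hi, nth_eq_of_mids_mirror hm] at e1 e2
  rw [← f1, mirrorRow_side] at e1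
  rw [← f2, mirrorRow_side] at e2
  exact ⟨Face.side_injective _ e1, Face.side_injective _ e2⟩

/-- … and crosses the sides of the reflected rhombus at the same indices. [cite: GlazmanManolescu2019, §4.2 (lattice symmetries)] -/
theorem hitIdx_eq_of_mids_mirror (hm : δ.mids = γ.mids.map (mirrorRow c)) (r : Face) :
    δ.hitIdx (mirrorRowFace c r) = γ.hitIdx r := by
  ext i
  rw [mem_hitIdx, mem_hitIdx, length_arcs_eq_of_mids_mirror hm, nth_eq_of_mids_mirror hm]
  constructor
  · rintro ⟨hi, s, hs⟩
    refine ⟨hi, mirrorSide s, mirrorRow_injective c ?_⟩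
    rw [hs, side_mirrorRowFace]
  · rintro ⟨hi, s, hs⟩
    refine ⟨hi, mirrorSide s, ?_⟩
    rw [hs, side_mirrorRowFace, mirrorSide_mirrorSide]

end MirrorMids

/-- **The first hit of the reflected rhombus happens at the same index.** [cite: Glazman2015WeightedSAW, Lemma 3.1 (proof, pp. 6–7: the first crossing of ∂r)] -/
theorem firstHitG_eq_of_mids_mirror {D D' : Set Face} {a a' : MidEdge} {c : ℤ} {r : Face} {sE sE' : Side}
    {γ : YBWalk D a (r.side sE)} {δ : YBWalk D' a' ((mirrorRowFace c r).side sE')}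
    (hm : δ.mids = γ.mids.map (mirrorRow c)) : δ.firstHitG = γ.firstHitG := by
  have hset := hitIdx_eq_of_mids_mirror hm r
  unfold firstHitG
  apply le_antisymm
  · exact Finset.min'_le _ _ (by rw [hset]; exact Finset.min'_mem _ _)
  · exact Finset.min'_le _ _ (by rw [← hset]; exact Finset.min'_mem _ _)

end YBWalk

namespace ΩG

open YBWalk
open private fc_fh fc_ne fh_add_Mv from Literature.Probability.RandomPlanarGeometry.YangBaxterSAWGeneralDomain
open private side_jOut from Literature.Probability.RandomPlanarGeometry.YangBaxterSAWExcursionJordan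

variable {D D' : Set Face} {a a' : MidEdge} {r : Face} {c : ℤ} {ω : ΩG D a r} {hr : RootedFace D a r}
  {ω' : ΩG D' a' (mirrorRowFace c r)} {hr' : RootedFace D' a' (mirrorRowFace c r)}

/-- The reflected walk has the same number of slots. [cite: Glazman2015WeightedSAW, Lemma 3.1 (proof, pp. 6–7)] -/
theorem Mv_eq_of_mids_mirror (hm : ω'.2.mids = ω.2.mids.map (mirrorRow c)) : ω'.Mv = ω.Mv := by
  unfold Mv
  rw [length_arcs_eq_of_mids_mirror hm, firstHitG_eq_of_mids_mirror hm]

/-- **The returning class is preserved by the reflection**: the reflected walk of a class-`B2a` walk at `r` is of class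
`B2a` at the reflected rhombus. [cite: Glazman2015WeightedSAW, Lemma 3.1 (proof, pp. 6–7: the classes of walks through a rhombus)]
[cite: GlazmanManolescu2019, §4.2 (lattice symmetries)] -/
theorem isB2a_of_mids_mirror (hr : RootedFace D a r) (hm : ω'.2.mids = ω.2.mids.map (mirrorRow c)) (h : ω.IsB2a) :
    ω'.IsB2a := by
  have hM : 3 ≤ ω.Mv := three_le_Mv hr h
  have hFM : ω.2.firstHitG + ω.Mv = ω.2.arcs.length := fh_add_Mv h
  have hF : ω'.2.firstHitG = ω.2.firstHitG := firstHitG_eq_of_mids_mirror hm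
  have hn : ω'.2.arcs.length = ω.2.arcs.length := length_arcs_eq_of_mids_mirror hm
  refine isB2a_of_forall_fc_ne (by omega) fun j hj1 hj2 e => ?_
  rw [fc_eq_of_mids_mirror hm (by omega)] at e
  exact fc_ne ω hr h (by omega) (by omega) (mirrorRowFace_injective c e)

/-- The arc in the reflected rhombus is the reflected arc: its kind is the mirror kind (`θ`-corner ↔ `(π−θ)`-corner).
[cite: GlazmanManolescu2019, §1, Fig. 1 (the arc configurations; θ ↔ π − θ)] [cite: Glazman2015WeightedSAW, Lemma 3.1 (proof, pp. 6–7)] -/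
theorem arcKind_firstSideG_z1_of_mids_mirror (hm : ω'.2.mids = ω.2.mids.map (mirrorRow c)) (h : ω.IsB2a) (h' : ω'.IsB2a) :
    arcKind ω'.2.firstSideG (ω'.z1 hr' h') = mirrorKind (arcKind ω.2.firstSideG (ω.z1 hr h)) := by
  obtain ⟨-, hsIn, hsOut⟩ := fc_fh ω hr h
  obtain ⟨-, hsIn', hsOut'⟩ := fc_fh ω' hr' h'
  have hF : ω'.2.firstHitG = ω.2.firstHitG := firstHitG_eq_of_mids_mirror hm
  obtain ⟨e1, e2⟩ := sIn_sOut_eq_of_mids_mirror hm (i := ω.2.firstHitG) (ω.fh_lt h)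
  have e1' : ω'.2.firstSideG = mirrorSide ω.2.firstSideG := by
    rw [← hsIn', hF, e1, hsIn]
  have e2' : ω'.z1 hr' h' = mirrorSide (ω.z1 hr h) := by
    show ω'.2.exitSideG hr' (ω'.fh_lt h') = mirrorSide (ω.2.exitSideG hr (ω.fh_lt h))
    rw [← hsOut', ← hsOut, hF, e2]
  rw [e1', e2', arcKind_mirrorSide]

open scoped Classical in
/-- **The ray count of the reflected walk**: the reflected excursion polygon crosses the ray behind the `W` side of
`(b.1, 2c − b.2 + 1)` — the reflection of the ray behind the `W` side of `b` — as often as the original crosses the latter.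
[cite: CourantRobbins1958, Ch. V Appendix §2 (the even–odd rule)] [cite: GlazmanManolescu2019, §4.2 (lattice symmetries)] -/
theorem rayCountAt_W_of_mids_mirror (hm : ω'.2.mids = ω.2.mids.map (mirrorRow c)) (h : ω.IsB2a) (h' : ω'.IsB2a)
    (b : Face) : ω'.rayCountAt hr' h' ((b.1 : ℤ), (2 * c - b.2 + 1 : ℤ)) .W = ω.rayCountAt hr h b .W := by
  have hF : ω'.2.firstHitG = ω.2.firstHitG := firstHitG_eq_of_mids_mirror hm
  have hMv : ω'.Mv = ω.Mv := Mv_eq_of_mids_mirror hm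
  unfold rayCountAt
  rw [hMv]
  refine congrArg Finset.card (Finset.filter_congr fun j hj => ?_)
  rw [Finset.mem_range] at hj
  rw [side_jOut h' (by rw [hMv]; exact hj), side_jOut h hj, hF, nth_eq_of_mids_mirror hm]
  constructor
  · rintro ⟨m, hm'⟩
    refine ⟨m, mirrorRow_injective c ?_⟩
    rw [hm', mirrorRow_rayMid_W]
  · rintro ⟨m, hm'⟩
    exact ⟨m, by rw [hm', mirrorRow_rayMid_W]⟩

/-- ★★★ **THE SECOND TRIANGULATION: ENCIRCLING IN THE REFLECTED HONEYCOMB LATTICE ⟺ WOUND.** Root at the origin, `Dl ∌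
(−1, 0)`, `ω` a walk of class `B2a` at `f` whose arc in `f` is not a `(π − θ)`-corner arc; `ω'` the walk of the ROW-REFLECTED
list `ρDl` (reflection in the row of the origin rhombus, fixing the root) whose mid-edges are the reflected mid-edges of `ω`
(the second-angle file's `mirrorWalkEquivMap 0`), of non-zero `π/3`-weight (= the `2π/3`-weight of `ω`). Then the loop of the
honeycomb walk of `ω'` — the walk of `ω` on the OTHER triangulation, the one the second hexagonal angle `2π/3` sees — winds
about the root face iff the excursion polygon of `ω` winds about the root: the reflection exchanges the two rays behind the two
ends of the root edge (§6). Together with edition 1: a wound returning walk with BOTH weights non-zero is seen by at least one of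
the two hexagonal lattices (by both if its arc in `f` is straight); invisibility to both forces a vanishing weight.
[cite: GlazmanManolescu2019, §1 (θ ↔ π − θ; the two hexagonal endpoints), Lemma 2.1] [cite: DuminilCopinSmirnov2012, proof of Lemma 1]
[cite: Glazman2015WeightedSAW, Lemma 3.1 (proof, pp. 6–7)] [cite: CourantRobbins1958, Ch. V Appendix §2 (the even–odd rule)] -/
theorem loopWnd_hvWalk_mirror_ne_zero_iff_AJ_root_ne_zero {Dl : List Face} {f : Face}
    {ω : ΩG (PlaquetteWalk.dom Dl) origin f} {hr : RootedFace (PlaquetteWalk.dom Dl) origin f}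
    {ω' : ΩG (PlaquetteWalk.dom (Dl.map (mirrorRowFace 0))) origin (mirrorRowFace 0 f)}
    (hD : ((-1 : ℤ), (0 : ℤ)) ∉ Dl) (h : ω.IsB2a) (hm : ω'.2.mids = ω.2.mids.map (mirrorRow 0))
    (hκ : arcKind ω.2.firstSideG (ω.z1 hr h) ≠ .coCorner) (hw : ω'.2.weight (fun _ => π / 3) ≠ 0) :
    HV.loopWnd ((mirrorRowFace 0 f).hv ω'.1) ω'.2.hvWalk ≠ 0 ↔ ω.AJ hr h (toC (midPt origin)) ≠ 0 := by
  have hD' : ((-1 : ℤ), (0 : ℤ)) ∉ Dl.map (mirrorRowFace 0) := by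
    rw [List.mem_map]
    rintro ⟨g, hg, he⟩
    obtain ⟨k, j⟩ := g
    simp only [mirrorRowFace, Prod.mk.injEq] at he
    obtain ⟨rfl, h2⟩ := he
    have hj : j = 0 := by omega
    subst hj
    exact hD hg
  have hr' : RootedFace (PlaquetteWalk.dom (Dl.map (mirrorRowFace 0))) origin (mirrorRowFace 0 f) :=
    ⟨List.mem_map.2 ⟨f, hr.mem, rfl⟩, fun hh => hD' hh.1⟩
  have h' : ω'.IsB2a := isB2a_of_mids_mirror hr hm h
  have hκ' : arcKind ω'.2.firstSideG (ω'.z1 hr' h') ≠ .corner := by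
    rw [arcKind_firstSideG_z1_of_mids_mirror (hr := hr) (hr' := hr') hm h h']
    intro e
    apply hκ
    rw [← Literature.Barriers.CriticalPhenomena.PlaquetteWalk.mirrorKind_mirrorKind (arcKind _ _), e]
    rfl
  have hray := rayCountAt_W_of_mids_mirror (hr := hr) (hr' := hr') hm h h' ((0 : ℤ), (1 : ℤ))
  norm_num at hray
  rw [loopWnd_hvWalk_ne_zero_iff_odd_rayCountAt hD' h' hκ' hw, hray,
    AJ_root_ne_zero_iff_odd_rayCountAt_north (hr := hr) h (b := ((0 : ℤ), (0 : ℤ))) rfl]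
  norm_num

/-- The hypothesis of the previous theorem is met canonically: MirrorDuality's reflected walk `mirrorWalk 0 … ω.2` of the
row-reflected list (the second-angle file's `mirrorWalkEquivMap 0`, up to the presentation of its endpoints) is a walk from the
origin to the reflected side with the reflected mid-edges. [cite: GlazmanManolescu2019, §1 (θ ↔ π − θ), §4.2 (lattice symmetries)] -/
theorem exists_mirror_mids {Dl : List Face} {f : Face} (ω : ΩG (PlaquetteWalk.dom Dl) origin f) :
    ∃ ω' : ΩG (PlaquetteWalk.dom (Dl.map (mirrorRowFace 0))) origin (mirrorRowFace 0 f),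
      ω'.1 = mirrorSide ω.1 ∧ ω'.2.mids = ω.2.mids.map (mirrorRow 0) := by
  refine ⟨⟨mirrorSide ω.1, Literature.Barriers.CriticalPhenomena.PlaquetteWalk.MirrorWalk.mirrorWalk 0
    (fun g hg => (Literature.Barriers.CriticalPhenomena.PlaquetteWalk.mem_dom_map_mirrorRowFace 0 Dl _).2
      (by rwa [mirrorRowFace_mirrorRowFace]))
    (by simp [mirrorRow, origin]) (mirrorRow_side 0 f ω.1) ω.2⟩, rfl, rfl⟩

end ΩG

end SecondTriangulation


/-! ## §8. The dictionary at every `W`-rooted hole (edition 5): the class-`B2a` anatomy under translation; the encircling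
term of a returning walk -/

section EveryWRoot

/-- A translation carries the ray behind the `W` side of `b` to the ray behind the `W` side of the translated rhombus. [folklore]
[cite: CourantRobbins1958, Ch. V Appendix §2 (the even–odd rule: a ray of the lattice)] -/
theorem shiftBy_rayMid_W (v : ℤ × ℤ) (b : Face) (m : ℕ) :
    (rayMid b .W m).shiftBy v = rayMid (Face.shiftBy v b) .W m := by
  obtain ⟨b₁, b₂⟩ := b
  obtain ⟨v₁, v₂⟩ := v
  simp only [rayMid, rayCell, raySide, Face.side, Face.shiftBy, MidEdge.shiftBy, MidEdge.slant.injEq, and_true]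
  ring

namespace YBWalk

section ShiftMids

variable {D D' : Set Face} {a z a' z' : MidEdge} {v : ℤ × ℤ} {γ : YBWalk D a z} {δ : YBWalk D' a' z'}

/-- A walk whose mid-edges are the translated mid-edges starts at the translated start. [cite: GlazmanManolescu2019, §4.2 (translation invariance)] -/
theorem start_eq_of_mids_shift (hm : δ.mids = γ.mids.map (MidEdge.shiftBy v)) : a' = a.shiftBy v := by
  have h1 := δ.head_eq
  rw [hm, List.head?_map, γ.head_eq, Option.map_some, Option.some.injEq] at h1
  exact h1.symm

/-- … and has as many arcs. [cite: GlazmanManolescu2019, §4.2 (translation invariance)] -/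
theorem length_arcs_eq_of_mids_shift (hm : δ.mids = γ.mids.map (MidEdge.shiftBy v)) : δ.arcs.length = γ.arcs.length := by
  rw [δ.length_arcs, γ.length_arcs, hm, List.length_map]

/-- … and its `i`-th mid-edge is the translated one. [cite: GlazmanManolescu2019, §4.2 (translation invariance)] -/
theorem nth_eq_of_mids_shift (hm : δ.mids = γ.mids.map (MidEdge.shiftBy v)) (i : ℕ) : δ.nth i = (γ.nth i).shiftBy v := by
  unfold nth
  rw [hm, start_eq_of_mids_shift hm, List.getD_map]

/-- … and its `i`-th arc lies in the translated rhombus. [cite: GlazmanManolescu2019, §4.2 (translation invariance)] -/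
theorem fc_eq_of_mids_shift (hm : δ.mids = γ.mids.map (MidEdge.shiftBy v)) {i : ℕ} (hi : i < γ.arcs.length) :
    δ.fc i = Face.shiftBy v (γ.fc i) := by
  have hi' : i < δ.arcs.length := by rwa [length_arcs_eq_of_mids_shift hm]
  have h1 := δ.arcFace_nth_eq_fc hi'
  rw [nth_eq_of_mids_shift hm, nth_eq_of_mids_shift hm] at h1
  have key : arcFace ((γ.nth i).shiftBy v, (γ.nth (i + 1)).shiftBy v) =
      (arcFace (γ.nth i, γ.nth (i + 1))).map (Face.shiftBy v) := arcFace_shiftBy v (γ.nth i, γ.nth (i + 1))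
  rw [key, γ.arcFace_nth_eq_fc hi, Option.map_some, Option.some.injEq] at h1
  exact h1.symm

/-- … through the same sides. [cite: GlazmanManolescu2019, §4.2 (translation invariance)] -/
theorem sIn_sOut_eq_of_mids_shift (hm : δ.mids = γ.mids.map (MidEdge.shiftBy v)) {i : ℕ} (hi : i < γ.arcs.length) :
    δ.sIn i = γ.sIn i ∧ δ.sOut i = γ.sOut i := by
  have hi' : i < δ.arcs.length := by rwa [length_arcs_eq_of_mids_shift hm]
  obtain ⟨e1, e2⟩ := δ.side_sIn_eq_nth hi'
  obtain ⟨f1, f2⟩ := γ.side_sIn_eq_nth hi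
  rw [fc_eq_of_mids_shift hm hi, nth_eq_of_mids_shift hm] at e1 e2
  rw [← f1, ← Face.side_shiftBy] at e1
  rw [← f2, ← Face.side_shiftBy] at e2
  exact ⟨Face.side_injective _ e1, Face.side_injective _ e2⟩

/-- … and crosses the sides of the translated rhombus at the same indices. [cite: GlazmanManolescu2019, §4.2 (translation invariance)] -/
theorem hitIdx_eq_of_mids_shift (hm : δ.mids = γ.mids.map (MidEdge.shiftBy v)) (r : Face) :
    δ.hitIdx (Face.shiftBy v r) = γ.hitIdx r := by
  ext i
  rw [mem_hitIdx, mem_hitIdx, length_arcs_eq_of_mids_shift hm, nth_eq_of_mids_shift hm]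
  constructor
  · rintro ⟨hi, s, hs⟩
    refine ⟨hi, s, MidEdge.shiftBy_injective v ?_⟩
    rw [hs, Face.side_shiftBy]
  · rintro ⟨hi, s, hs⟩
    exact ⟨hi, s, by rw [hs, Face.side_shiftBy]⟩

end ShiftMids

/-- The first hit of the translated rhombus happens at the same index. [cite: Glazman2015WeightedSAW, Lemma 3.1 (proof, pp. 6–7)] -/
theorem firstHitG_eq_of_mids_shift {D D' : Set Face} {a a' : MidEdge} {v : ℤ × ℤ} {r : Face} {sE sE' : Side}
    {γ : YBWalk D a (r.side sE)} {δ : YBWalk D' a' ((Face.shiftBy v r).side sE')}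
    (hm : δ.mids = γ.mids.map (MidEdge.shiftBy v)) : δ.firstHitG = γ.firstHitG := by
  have hset := hitIdx_eq_of_mids_shift hm r
  unfold firstHitG
  apply le_antisymm
  · exact Finset.min'_le _ _ (by rw [hset]; exact Finset.min'_mem _ _)
  · exact Finset.min'_le _ _ (by rw [← hset]; exact Finset.min'_mem _ _)

end YBWalk

namespace ΩG

open YBWalk
open private fc_fh fc_ne fh_add_Mv from Literature.Probability.RandomPlanarGeometry.YangBaxterSAWGeneralDomain
open private side_jOut from Literature.Probability.RandomPlanarGeometry.YangBaxterSAWExcursionJordan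

variable {D D' : Set Face} {a a' : MidEdge} {r : Face} {v : ℤ × ℤ} {ω : ΩG D a r} {hr : RootedFace D a r}
  {ω' : ΩG D' a' (Face.shiftBy v r)} {hr' : RootedFace D' a' (Face.shiftBy v r)}

/-- In class `B2a` the last arc is outside `r` (the excursion arrives at `∂r` from outside). [cite: Glazman2015WeightedSAW, Lemma 3.1 (proof, pp. 6–7)] -/
theorem fc_ne_of_isB2a (hr : RootedFace D a r) (h : ω.IsB2a) : ω.2.fc (ω.2.arcs.length - 1) ≠ r := by
  have hM : 3 ≤ ω.Mv := three_le_Mv hr h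
  have hFM : ω.2.firstHitG + ω.Mv = ω.2.arcs.length := fh_add_Mv h
  exact fc_ne ω hr h (by omega) (by omega)


/-- The translated walk has the same number of slots. [cite: Glazman2015WeightedSAW, Lemma 3.1 (proof, pp. 6–7)] -/
theorem Mv_eq_of_mids_shift (hm : ω'.2.mids = ω.2.mids.map (MidEdge.shiftBy v)) : ω'.Mv = ω.Mv := by
  unfold Mv
  rw [length_arcs_eq_of_mids_shift hm, firstHitG_eq_of_mids_shift hm]

/-- **The returning class is translation invariant.** [cite: Glazman2015WeightedSAW, Lemma 3.1 (proof, pp. 6–7)]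
[cite: GlazmanManolescu2019, §4.2 (translation invariance)] -/
theorem isB2a_of_mids_shift (hr : RootedFace D a r) (hm : ω'.2.mids = ω.2.mids.map (MidEdge.shiftBy v)) (h : ω.IsB2a) :
    ω'.IsB2a := by
  have hM : 3 ≤ ω.Mv := three_le_Mv hr h
  have hFM : ω.2.firstHitG + ω.Mv = ω.2.arcs.length := fh_add_Mv h
  have hF : ω'.2.firstHitG = ω.2.firstHitG := firstHitG_eq_of_mids_shift hm
  have hn : ω'.2.arcs.length = ω.2.arcs.length := length_arcs_eq_of_mids_shift hm
  refine isB2a_of_forall_fc_ne (by omega) fun j hj1 hj2 e => ?_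
  rw [fc_eq_of_mids_shift hm (by omega)] at e
  exact fc_ne ω hr h (by omega) (by omega) (Face.shiftBy_injective v e)

/-- The arc in the translated rhombus has the same kind. [cite: GlazmanManolescu2019, §4.2 (translation invariance)] -/
theorem arcKind_firstSideG_z1_of_mids_shift (hm : ω'.2.mids = ω.2.mids.map (MidEdge.shiftBy v)) (h : ω.IsB2a) (h' : ω'.IsB2a) :
    arcKind ω'.2.firstSideG (ω'.z1 hr' h') = arcKind ω.2.firstSideG (ω.z1 hr h) := by
  obtain ⟨-, hsIn, hsOut⟩ := fc_fh ω hr h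
  obtain ⟨-, hsIn', hsOut'⟩ := fc_fh ω' hr' h'
  have hF : ω'.2.firstHitG = ω.2.firstHitG := firstHitG_eq_of_mids_shift hm
  obtain ⟨e1, e2⟩ := sIn_sOut_eq_of_mids_shift hm (i := ω.2.firstHitG) (ω.fh_lt h)
  have e1' : ω'.2.firstSideG = ω.2.firstSideG := by rw [← hsIn', hF, e1, hsIn]
  have e2' : ω'.z1 hr' h' = ω.z1 hr h := by
    show ω'.2.exitSideG hr' (ω'.fh_lt h') = ω.2.exitSideG hr (ω.fh_lt h)
    rw [← hsOut', ← hsOut, hF, e2]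
  rw [e1', e2']

open scoped Classical in
/-- **The ray count is translation invariant** (ray and walk translated together). [cite: CourantRobbins1958, Ch. V Appendix §2 (the even–odd rule)]
[cite: GlazmanManolescu2019, §4.2 (translation invariance)] -/
theorem rayCountAt_W_of_mids_shift (hm : ω'.2.mids = ω.2.mids.map (MidEdge.shiftBy v)) (h : ω.IsB2a) (h' : ω'.IsB2a)
    (b : Face) : ω'.rayCountAt hr' h' (Face.shiftBy v b) .W = ω.rayCountAt hr h b .W := by
  have hF : ω'.2.firstHitG = ω.2.firstHitG := firstHitG_eq_of_mids_shift hm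
  have hMv : ω'.Mv = ω.Mv := Mv_eq_of_mids_shift hm
  unfold rayCountAt
  rw [hMv]
  refine congrArg Finset.card (Finset.filter_congr fun j hj => ?_)
  rw [Finset.mem_range] at hj
  rw [side_jOut h' (by rw [hMv]; exact hj), side_jOut h hj, hF, nth_eq_of_mids_shift hm]
  constructor
  · rintro ⟨m, hm'⟩
    refine ⟨m, MidEdge.shiftBy_injective v ?_⟩
    rw [hm', shiftBy_rayMid_W]
  · rintro ⟨m, hm'⟩
    exact ⟨m, by rw [hm', shiftBy_rayMid_W]⟩

/-- ★★★ **THE DICTIONARY AT EVERY `W`-ROOTED HOLE: ENCIRCLING ⟺ WOUND.** For a finite face list `Dl`, a root on the `W` side of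
ANY rhombus `w` whose western neighbour is outside the list, a walk `ω` of class `B2a` at `f` from that root whose arc in `f` is not a
`θ`-corner arc, and the TRANSLATED walk `ω'` (translation by `−w`, the dictionary's `YBWalk.shiftByEquiv (−w)` of §13: a walk of
`dom (Dl − w)` from the origin to the translated side, `ΩG.exists_shift_mids`) of non-zero `π/3`-weight (= the weight of `ω`): the
loop of the honeycomb walk of `ω'` — the honeycomb walk of `ω` read in the honeycomb coordinates centred at `w`, as in the
dictionary's §14/§15 — winds about the root face iff the excursion polygon of `ω` winds about the midpoint of the root `w.side W`.
[cite: GlazmanManolescu2019, §4.2 (translation invariance), Lemma 2.1] [cite: DuminilCopinSmirnov2012, proof of Lemma 1]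
[cite: Glazman2015WeightedSAW, Lemma 3.1 (proof, pp. 6–7)] [cite: CourantRobbins1958, Ch. V Appendix §2 (the even–odd rule)] -/
theorem loopWnd_hvWalk_shift_ne_zero_iff_AJ_root_ne_zero {Dl : List Face} {w f : Face}
    {ω : ΩG (PlaquetteWalk.dom Dl) (w.side .W) f} {hr : RootedFace (PlaquetteWalk.dom Dl) (w.side .W) f}
    {ω' : ΩG (PlaquetteWalk.dom (Dl.map (Face.shiftBy (-w)))) origin (Face.shiftBy (-w) f)}
    (hw : ((w.1 - 1 : ℤ), w.2) ∉ Dl) (h : ω.IsB2a) (hm : ω'.2.mids = ω.2.mids.map (MidEdge.shiftBy (-w)))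
    (hκ : arcKind ω.2.firstSideG (ω.z1 hr h) ≠ .corner) (hwt : ω'.2.weight (fun _ => π / 3) ≠ 0) :
    HV.loopWnd ((Face.shiftBy (-w) f).hv ω'.1) ω'.2.hvWalk ≠ 0 ↔ ω.AJ hr h (toC (midPt (w.side .W))) ≠ 0 := by
  have hD' : ((-1 : ℤ), (0 : ℤ)) ∉ Dl.map (Face.shiftBy (-w)) := by
    rw [List.mem_map]
    rintro ⟨g, hg, he⟩
    obtain ⟨k, j⟩ := g
    obtain ⟨w₁, w₂⟩ := w
    simp only [Face.shiftBy, Prod.neg_mk, Prod.mk.injEq] at he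
    have hk : k = w₁ - 1 := by omega
    have hj : j = w₂ := by omega
    subst hk hj
    exact hw hg
  have hr' : RootedFace (PlaquetteWalk.dom (Dl.map (Face.shiftBy (-w)))) origin (Face.shiftBy (-w) f) :=
    ⟨List.mem_map.2 ⟨f, hr.mem, rfl⟩, fun hh => hD' hh.1⟩
  have h' : ω'.IsB2a := isB2a_of_mids_shift hr hm h
  have hκ' : arcKind ω'.2.firstSideG (ω'.z1 hr' h') ≠ .corner := by
    rw [arcKind_firstSideG_z1_of_mids_shift (hr := hr) (hr' := hr') hm h h']; exact hκ
  have hray := rayCountAt_W_of_mids_shift (hr := hr) (hr' := hr') hm h h' w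
  have hw0 : Face.shiftBy (-w) w = ((0 : ℤ), (0 : ℤ)) := by
    obtain ⟨w₁, w₂⟩ := w; simp [Face.shiftBy]
  rw [hw0] at hray
  rw [loopWnd_hvWalk_ne_zero_iff_odd_rayCountAt hD' h' hκ' hwt, hray,
    AJ_root_ne_zero_iff_odd_rayCountAt (hr := hr) h (b := w) (τ := .W) rfl]

/-- The hypothesis of the previous theorem is met canonically by the dictionary's translated walk `YBWalk.shiftBy (−w)` (§13), up to
the presentation of its endpoints. [cite: GlazmanManolescu2019, §4.2 (translation invariance)] -/
theorem exists_shift_mids {Dl : List Face} {w f : Face} (ω : ΩG (PlaquetteWalk.dom Dl) (w.side .W) f) :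
    ∃ ω' : ΩG (PlaquetteWalk.dom (Dl.map (Face.shiftBy (-w)))) origin (Face.shiftBy (-w) f),
      ω'.1 = ω.1 ∧ ω'.2.mids = ω.2.mids.map (MidEdge.shiftBy (-w)) := by
  have hz : (f.side ω.1).shiftBy (-w) = (Face.shiftBy (-w) f).side ω.1 := (Face.side_shiftBy (-w) f ω.1).symm
  have ha : (w.side Side.W).shiftBy (-w) = origin := by
    obtain ⟨w₁, w₂⟩ := w
    simp [Face.side, MidEdge.shiftBy, origin]
  refine ⟨⟨ω.1, ((ω.2.shiftBy (-w)).castAll (dom_map_shiftBy (-w) Dl).symm ha hz)⟩, rfl, ?_⟩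
  rfl

end ΩG

/-! ### The encircling term of a returning walk -/

/-- ★★ **THE ENCIRCLING TERM OF A RETURNING WALK IS ITS PARAFERMIONIC WEIGHT TIMES THE (CR) COEFFICIENT OF ITS SIDE.** For a
Yang–Baxter walk from the origin of non-zero `π/3`-weight ending on the side `s` of `f` and arriving from outside `f`, the summand
`edir · x_c^ℓ λ^{pturn}` that its honeycomb walk contributes to Duminil-Copin–Smirnov's relation at the triangle `f.hv s` (the
summand of the dictionary's §15 / the lane's `sum_cv_eq_sum_encircling`) equals `(2ω − 1) · crCoef (π/3) s · paraWeight γ` —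
Glazman–Manolescu's contour coefficient of the side `s` in (CR) times the walk's parafermionic weight, up to the fixed factor
`2ω − 1 = i√3` of the dictionary's §12. [cite: GlazmanManolescu2019, Lemma 2.1, eq. (2.2) (CR)]
[cite: DuminilCopinSmirnov2012, Lemma 1 («(p − v)F(p) + (q − v)F(q) + (r − v)F(r) = 0») and its proof] -/
theorem YBWalk.edir_mul_pwt_hvWalk_eq {D : Set Face} (hD : ((-1 : ℤ), (0 : ℤ)) ∉ D) {f : Face} {s : Side}
    (γ : YBWalk D origin (f.side s)) (hn : 0 < γ.arcs.length) (hch : γ.fc (γ.arcs.length - 1) ≠ f)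
    (hw : γ.weight (fun _ => π / 3) ≠ 0) :
    HV.edir (f.hv s) (HV.finalDart γ.hvWalk).1 * HV.pwt γ.hvWalk =
      (2 * HV.omg - 1) * crCoef (π / 3) s * γ.paraWeight (fun _ => π / 3) := by
  rw [γ.finalDart_hvWalk_of_origin hD hn, γ.paraWeight_pi_div_three hw]
  have hlast : γ.lastTri = f.hvAcross s := by
    unfold YBWalk.lastTri
    exact (Face.hvAcross_eq_of_side_eq (YBWalk.side_sOut_lastG hn).symm (Ne.symm hch)).symm
  rw [hlast, edir_hv_hvAcross]

/-- ★★ **The encircling term of a wound returning walk** (class `B2a` at `f` from the origin, non-`θ`-corner arc, non-zero weight):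
its honeycomb walk is one of the encircling loop-class walks of the dictionary's §15 at the triangle `f.hv ω.1` iff it is wound
(edition 1), and its term there is `(2ω − 1) · crCoef (π/3) ω.1 · paraWeight ω.2`. [cite: GlazmanManolescu2019, Lemma 2.1, eq. (2.2) (CR)]
[cite: DuminilCopinSmirnov2012, Lemma 1 and its proof] [cite: Glazman2015WeightedSAW, Lemma 3.1 (proof, pp. 6–7)] -/
theorem ΩG.edir_mul_pwt_hvWalk_eq {D : Set Face} (hD : ((-1 : ℤ), (0 : ℤ)) ∉ D) {f : Face}
    {ω : ΩG D origin f} (hr : RootedFace D origin f) (h : ω.IsB2a) (hw : ω.2.weight (fun _ => π / 3) ≠ 0) :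
    HV.edir (f.hv ω.1) (HV.finalDart ω.2.hvWalk).1 * HV.pwt ω.2.hvWalk =
      (2 * HV.omg - 1) * crCoef (π / 3) ω.1 * ω.2.paraWeight (fun _ => π / 3) := by
  have hM : 3 ≤ ω.Mv := ΩG.three_le_Mv hr h
  have hMv : ω.Mv = ω.2.arcs.length - ω.2.firstHitG := rfl
  exact YBWalk.edir_mul_pwt_hvWalk_eq hD ω.2 (by omega) (ΩG.fc_ne_of_isB2a hr h) hw

end EveryWRoot


/-! ## §9. The `θ`-corner returning walks (edition 6): pushed across the short diagonal they are Duminil-Copin–Smirnov's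
DIAGONAL-ending encircling walks — the dictionary of the two third classes is complete -/

section CornerWalks

namespace ΩG

open YBWalk HV
open private fc_fh fc_ne fh_add_Mv firstHit_le_of_memG arcFace_firstHitG
  from Literature.Probability.RandomPlanarGeometry.YangBaxterSAWGeneralDomain

variable {D : Set Face} {f : Face} {ω : ΩG D origin f} {hr : RootedFace D origin f}

/-- **A `θ`-corner returning walk returns through the OTHER triangle**: its arc in `f` uses the two sides of one triangle, so the
return side lies on the other one. [cite: Glazman2015WeightedSAW, Lemma 3.1 (proof, pp. 6–7: the classes of walks through a rhombus)]
[cite: GlazmanManolescu2019, §1 (Fig. 2: each triangle carries two sides of its rhombus)] -/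
theorem tri_fst_ne_of_corner (h : ω.IsB2a) (hc : arcKind ω.2.firstSideG (ω.z1 hr h) = .corner) :
    (ω.1).tri ≠ ω.2.firstSideG.tri := by
  have hfh : ω.2.firstHitG < ω.2.arcs.length := ω.fh_lt h
  obtain ⟨hfc, hsIn, hsOut⟩ := fc_fh ω hr h
  have hst : ω.2.firstSideG ≠ ω.z1 hr h := by
    rw [← hsIn, ← show ω.2.sOut ω.2.firstHitG = ω.z1 hr h from hsOut]
    exact (YBWalk.side_sIn hfh).2.2
  have htri : ω.2.firstSideG.tri = (ω.z1 hr h).tri := (arcKind_eq_corner_iff hst).1 hc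
  have hd := ω.2.sides_distinctG hr h.1
  rw [ω.returnSide_of_isB2a h] at hd
  intro e
  rcases Side.eq_or_eq_of_tri_eq e htri hst with e1 | e1
  · exact hd.2.1 e1
  · exact hd.2.2 e1


/-- ★★ **THE HONEYCOMB WALK OF A `θ`-CORNER RETURNING WALK, PUSHED ACROSS THE SHORT DIAGONAL, IS A LOOP WALK AT THE ARC'S
TRIANGLE.** Root at the origin, `ω` of class `B2a` at `f` with a `θ`-CORNER arc in `f` (one triangle `T = f.hv z₀` only; the
walk returns through a side of the other triangle `T' = f.hv ω.1`). Then `hvWalk ω ++ [T]` — the honeycomb walk continued by the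
half-edge from `T'` towards `T` along the short diagonal — is a loop walk `w, l₁, T, l₂, T` at `T`, and the winding number of its
loop about the root face is the signed number of crossings of the ray behind the root by the exit half-edges of the slots of the
excursion polygon (the closing diagonal dart never crosses). [cite: GlazmanManolescu2019, §1 (Fig. 2), Lemma 2.1]
[cite: Glazman2015WeightedSAW, Lemma 3.1 (proof, pp. 6–7)] [cite: DuminilCopinSmirnov2012, proof of Lemma 1 (the walks passing all three mid-edges of a vertex)] -/
theorem exists_hvWalk_append_eq_lw_of_corner (hD : ((-1 : ℤ), (0 : ℤ)) ∉ D) (h : ω.IsB2a)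
    (hc : arcKind ω.2.firstSideG (ω.z1 hr h) = .corner) :
    ∃ l₁ l₂ : List HV, f.hv ω.2.firstSideG ∉ l₁ ∧ l₂ ≠ [] ∧
      ω.2.hvWalk ++ [f.hv ω.2.firstSideG] = HV.lw l₁ (f.hv ω.2.firstSideG) l₂ ∧
      HV.wnd (f.hv ω.2.firstSideG :: l₂) (1, 0) =
        ∑ j ∈ Finset.range ω.Mv,
          HV.dartWnd ((ω.2.fc (ω.2.firstHitG + j)).hv (ω.2.sOut (ω.2.firstHitG + j)),
            (ω.2.fc (ω.2.firstHitG + j)).hvAcross (ω.2.sOut (ω.2.firstHitG + j))) (1, 0) := by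
  have hfh : ω.2.firstHitG < ω.2.arcs.length := ω.fh_lt h
  have hM : 3 ≤ ω.Mv := three_le_Mv hr h
  have hFM : ω.2.firstHitG + ω.Mv = ω.2.arcs.length := fh_add_Mv h
  obtain ⟨hfc, hsIn, hsOut⟩ := fc_fh ω hr h
  have hz1 : ω.2.sOut ω.2.firstHitG = ω.z1 hr h := hsOut
  have hn : 0 < ω.2.arcs.length := by omega
  have hst : ω.2.firstSideG ≠ ω.z1 hr h := by
    rw [← hsIn, ← hz1]; exact (YBWalk.side_sIn hfh).2.2
  have htri : ω.2.firstSideG.tri = (ω.z1 hr h).tri := (arcKind_eq_corner_iff hst).1 hc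
  obtain ⟨L, hL, hlast, hsum⟩ :=
    exists_hvUpTo_eq_append (ω := ω) (i := ω.2.arcs.length) (by omega) le_rfl
  have hch : ω.2.fc (ω.2.arcs.length - 1) ≠ f := fc_ne ω hr h (by omega) (by omega)
  have hv : ω.2.acrossOut (ω.2.arcs.length - 1) = f.hv ω.1 := acrossOut_last_eq_hv rfl hn hch
  -- the corner arc crosses one triangle: `T = f.hv z₀ = f.hv z₁`
  have hT1 : (ω.2.fc ω.2.firstHitG).hv (ω.2.sOut ω.2.firstHitG) = f.hv ω.2.firstSideG := by
    rw [hfc, hz1]; exact Face.hv_eq_hv_iff.2 ⟨rfl, htri.symm⟩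
  have harc : ω.2.arcHV ω.2.firstHitG = [f.hv ω.2.firstSideG] := by
    unfold YBWalk.arcHV
    rw [hfc, hsIn, hz1, if_pos htri]
  have hwalk : ω.2.hvWalk = HV.wOut :: (ω.2.hvUpTo ω.2.firstHitG ++ [f.hv ω.2.firstSideG] ++ L ++ [f.hv ω.1]) := by
    rw [ω.2.hvWalk_of_origin hD hn, YBWalk.hvInner, hL, YBWalk.hvUpTo_succ, harc, hv]
  have hnot : ∀ s : Side, f.hv s ∉ ω.2.hvUpTo ω.2.firstHitG := by
    intro s hs
    obtain ⟨k, hk, t, he⟩ := exists_fc_of_mem_hvUpTo hs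
    have hkf : ω.2.fc k ≠ f := by
      intro e
      have hk' : k < ω.2.arcs.length := by omega
      have hface := (YBWalk.arcFace_arcAt hk').1
      rw [YBWalk.arcAt_eq hk', e, ← ω.2.nth_eq_getElem, ← ω.2.nth_eq_getElem] at hface
      exact ω.2.arcFace_ne_of_lt_firstHitG hk hk' hface
    exact hkf (Face.hv_eq_hv_iff.1 he.symm).1
  have hclose : HV.dartWnd ((ω.2.fc (ω.2.arcs.length - 1)).hv (ω.2.sOut (ω.2.arcs.length - 1)), f.hv ω.1) (1, 0) =
      HV.dartWnd ((ω.2.fc (ω.2.arcs.length - 1)).hv (ω.2.sOut (ω.2.arcs.length - 1)),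
        (ω.2.fc (ω.2.arcs.length - 1)).hvAcross (ω.2.sOut (ω.2.arcs.length - 1))) (1, 0) := by
    rw [← hv]; rfl
  have htotal : (∑ k ∈ Finset.Ico ω.2.firstHitG (ω.2.arcs.length - 1),
        HV.dartWnd ((ω.2.fc k).hv (ω.2.sOut k), (ω.2.fc k).hvAcross (ω.2.sOut k)) (1, 0)) +
      HV.dartWnd ((ω.2.fc (ω.2.arcs.length - 1)).hv (ω.2.sOut (ω.2.arcs.length - 1)),
        (ω.2.fc (ω.2.arcs.length - 1)).hvAcross (ω.2.sOut (ω.2.arcs.length - 1))) (1, 0) =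
      ∑ j ∈ Finset.range ω.Mv,
        HV.dartWnd ((ω.2.fc (ω.2.firstHitG + j)).hv (ω.2.sOut (ω.2.firstHitG + j)),
          (ω.2.fc (ω.2.firstHitG + j)).hvAcross (ω.2.sOut (ω.2.firstHitG + j))) (1, 0) := by
    rw [← Finset.sum_Ico_succ_top (by omega), show ω.2.arcs.length - 1 + 1 = ω.2.arcs.length by omega,
      Finset.sum_Ico_eq_sum_range, show ω.2.arcs.length - ω.2.firstHitG = ω.Mv by omega]
  refine ⟨ω.2.hvUpTo ω.2.firstHitG, L ++ [f.hv ω.1], hnot _, by simp, ?_, ?_⟩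
  · rw [hwalk, HV.lw]
    simp
  · rw [← hT1]
    have hgl : ((ω.2.fc ω.2.firstHitG).hv (ω.2.sOut ω.2.firstHitG) :: (L ++ [f.hv ω.1])).getLast (List.cons_ne_nil _ _) =
        f.hv ω.1 := by simp
    rw [HV.wnd_eq_dwnd, HV.cdarts_eq (List.cons_ne_nil _ _), HV.dwnd_append, List.head_cons, hgl,
      show HV.pdarts ((ω.2.fc ω.2.firstHitG).hv (ω.2.sOut ω.2.firstHitG) :: (L ++ [f.hv ω.1])) =
        HV.pdarts (((ω.2.fc ω.2.firstHitG).hv (ω.2.sOut ω.2.firstHitG) :: L) ++ [f.hv ω.1]) from rfl,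
      HV.pdarts_append_singleton _ (List.cons_ne_nil _ _), HV.dwnd_append, hsum, hlast, HV.dwnd_cons, HV.dwnd_nil,
      add_zero, hclose, htotal, HV.dwnd_cons, HV.dwnd_nil, add_zero, hT1, dartWnd_hv_hv, add_zero]

/-- ★★ For a `θ`-corner returning walk, the loop winding number of its pushed honeycomb walk is the signed ray crossing count,
hence ≡ the ray count behind the root (mod 2). [cite: DuminilCopinSmirnov2012, proof of Lemma 1]
[cite: CourantRobbins1958, Ch. V Appendix §2 (the even–odd rule)] [cite: Glazman2015WeightedSAW, Lemma 3.1 (proof, pp. 6–7)] -/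
theorem loopWnd_hvWalk_append_eq_rayCountAt_mod_two (hD : ((-1 : ℤ), (0 : ℤ)) ∉ D) (h : ω.IsB2a)
    (hc : arcKind ω.2.firstSideG (ω.z1 hr h) = .corner) :
    ((HV.loopWnd (f.hv ω.2.firstSideG) (ω.2.hvWalk ++ [f.hv ω.2.firstSideG]) : ℤ) : ZMod 2) =
      (ω.rayCountAt hr h ((0 : ℤ), (0 : ℤ)) .W : ZMod 2) := by
  classical
  obtain ⟨l₁, l₂, hv, -, he, hw⟩ := exists_hvWalk_append_eq_lw_of_corner (hr := hr) hD h hc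
  rw [he, HV.loopWnd_lw hv, hw, Int.cast_sum, ΩG.rayCountAt, Finset.natCast_card_filter]
  refine Finset.sum_congr rfl fun j _ => ?_
  rw [dartWnd_hv_hvAcross_mod_two, jFace_side_jOut_eq (hr := hr) h j]

/-- ★★ **THE PUSHED HONEYCOMB WALK OF A `θ`-CORNER RETURNING WALK IS AN ENCIRCLING-TYPE LOOP-CLASS WALK ENDING ON THE SHORT
DIAGONAL**, for a finite face list `Dl ∌ (−1, 0)` and non-zero `π/3`-weight: it is a self-avoiding mid-edge walk of the triangle
domain (the return triangle `T'` is fresh — the corner arc used `T` only), of the loop class at `T` (its final half-edge runs from `T'`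
towards `T` along the diagonal), and its loop winds about the root face iff the excursion polygon winds about the root.
[cite: DuminilCopinSmirnov2012, proof of Lemma 1 (the walks passing all three mid-edges of a vertex)] [cite: GlazmanManolescu2019, §1 (Fig. 2), Lemma 2.1]
[cite: Glazman2015WeightedSAW, Lemma 3.1 (proof, pp. 6–7)] [cite: CourantRobbins1958, Ch. V Appendix §2 (the even–odd rule)] -/
theorem hvWalk_append_mem_clsLoop_of_corner {Dl : List Face} {f : Face} {ω : ΩG (PlaquetteWalk.dom Dl) origin f}
    {hr : RootedFace (PlaquetteWalk.dom Dl) origin f} (hD : ((-1 : ℤ), (0 : ℤ)) ∉ Dl) (h : ω.IsB2a)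
    (hc : arcKind ω.2.firstSideG (ω.z1 hr h) = .corner) (hw : ω.2.weight (fun _ => π / 3) ≠ 0) :
    HV.IsMidWalk (triSet Dl.toFinset) (ω.2.hvWalk ++ [f.hv ω.2.firstSideG]) ∧
      ω.2.hvWalk ++ [f.hv ω.2.firstSideG] ∈ clsLoop (triSet Dl.toFinset) (f.hv ω.2.firstSideG) ∧
      (HV.loopWnd (f.hv ω.2.firstSideG) (ω.2.hvWalk ++ [f.hv ω.2.firstSideG]) ≠ 0 ↔
        ω.AJ hr h (toC (midPt origin)) ≠ 0) := by
  have hD' : ((-1 : ℤ), (0 : ℤ)) ∉ PlaquetteWalk.dom Dl := hD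
  have hDF : ((-1 : ℤ), (0 : ℤ)) ∉ Dl.toFinset := fun e => hD (List.mem_toFinset.1 e)
  have hwV : HV.wOut ∉ triSet Dl.toFinset := wOut_not_mem_triSet hDF
  have hV : ∀ g ∈ PlaquetteWalk.dom Dl, ∀ s : Side, g.hv s ∈ triSet Dl.toFinset :=
    fun g hg s => hv_mem_triSet (List.mem_toFinset.2 hg) s
  have hfh : ω.2.firstHitG < ω.2.arcs.length := ω.fh_lt h
  have hM : 3 ≤ ω.Mv := three_le_Mv hr h
  have hFM : ω.2.firstHitG + ω.Mv = ω.2.arcs.length := fh_add_Mv h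
  have hn : 0 < ω.2.arcs.length := by omega
  obtain ⟨hfc, hsIn, hsOut⟩ := fc_fh ω hr h
  have hz1 : ω.2.sOut ω.2.firstHitG = ω.z1 hr h := hsOut
  have hst : ω.2.firstSideG ≠ ω.z1 hr h := by
    rw [← hsIn, ← hz1]; exact (YBWalk.side_sIn hfh).2.2
  have htri : ω.2.firstSideG.tri = (ω.z1 hr h).tri := (arcKind_eq_corner_iff hst).1 hc
  have htri' : (ω.1).tri ≠ ω.2.firstSideG.tri := tri_fst_ne_of_corner (hr := hr) h hc
  have hch : ω.2.fc (ω.2.arcs.length - 1) ≠ f := fc_ne ω hr h (by omega) (by omega)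
  have hv : ω.2.acrossOut (ω.2.arcs.length - 1) = f.hv ω.1 := acrossOut_last_eq_hv rfl hn hch
  have hP := ω.2.isMidWalk_hvWalk_of_origin hD' hV hw
  have hwalk : ω.2.hvWalk = HV.wOut :: (ω.2.hvInner ++ [f.hv ω.1]) := by rw [ω.2.hvWalk_of_origin hD' hn, hv]
  have hne : ω.2.hvInner ≠ [] := hvUpTo_ne_nil hn
  rw [hwalk, HV.isMidWalk_cons_append_iff _ hne] at hP
  obtain ⟨hch1, hhd, hadj, hVin, hnd, hpr⟩ := hP
  -- `T'` is fresh: the corner arc crossed `T` only, and no other arc lies in `f`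
  have hTb : f.hv ω.1 ∉ ω.2.hvInner := by
    intro hm
    rw [YBWalk.hvInner, mem_hvUpTo_iff] at hm
    obtain ⟨k, hk, hmem⟩ := hm
    have hfk : ω.2.fc k = f := by
      rcases (mem_arcHV_iff (γ := ω.2)).1 hmem with e | e <;> exact ((Face.hv_eq_hv_iff.1 e).1).symm
    have hkF : k = ω.2.firstHitG := by
      by_contra hne'
      rcases Nat.lt_or_gt_of_ne hne' with hlt | hgt
      · have hface := (YBWalk.arcFace_arcAt hk).1
        rw [YBWalk.arcAt_eq hk, hfk, ← ω.2.nth_eq_getElem, ← ω.2.nth_eq_getElem] at hface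
        exact ω.2.arcFace_ne_of_lt_firstHitG hlt hk hface
      · exact fc_ne ω hr h hgt hk hfk
    subst hkF
    unfold YBWalk.arcHV at hmem
    rw [hfc, hsIn, hz1, if_pos htri, List.mem_singleton] at hmem
    exact htri' ((Face.hv_eq_hv_iff.1 hmem).2)
  -- the pushed walk is a mid-edge walk
  have hmw : HV.IsMidWalk (triSet Dl.toFinset) (ω.2.hvWalk ++ [f.hv ω.2.firstSideG]) := by
    rw [hwalk, List.cons_append, HV.isMidWalk_cons_append_iff _ (by simp)]
    refine ⟨?_, ?_, ?_, ?_, ?_, ?_⟩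
    · rw [List.isChain_append]
      refine ⟨hch1, List.isChain_singleton _, fun x hx y hy => ?_⟩
      rw [List.getLast?_eq_some_getLast hne, Option.mem_def, Option.some.injEq] at hx
      rw [List.head?_cons, Option.mem_def, Option.some.injEq] at hy
      subst hx hy
      exact hadj
    · rw [List.head?_append, hhd]; rfl
    · have hgl : (ω.2.hvInner ++ [f.hv ω.1]).getLast (by simp) = f.hv ω.1 := by simp
      rw [hgl]
      exact hv_adj_hv htri'
    · intro x hx
      rw [List.mem_append, List.mem_singleton] at hx
      rcases hx with hx | rfl
      · exact hVin x hx
      · exact hV f hr.mem ω.1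
    · exact List.nodup_append.2 ⟨hnd, List.nodup_singleton _, fun x hx y hy => by
        rw [List.mem_singleton] at hy; subst hy; exact fun e => hTb (e ▸ hx)⟩
    · obtain ⟨m, y, hm⟩ : ∃ m y, ω.2.hvInner = m ++ [y] := by
        rcases ω.2.hvInner.eq_nil_or_concat' with h0 | ⟨m, y, h0⟩
        · exact absurd h0 hne
        · exact ⟨m, y, h0⟩
      have hy : y = (ω.2.fc (ω.2.arcs.length - 1)).hv (ω.2.sOut (ω.2.arcs.length - 1)) := by
        have hl := ω.2.getLast_hvUpTo_length hn
        have hl' : (ω.2.hvUpTo ω.2.arcs.length).getLast (hvUpTo_ne_nil hn) = y := by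
          simp [show ω.2.hvUpTo ω.2.arcs.length = m ++ [y] from hm]
        rw [← hl', hl]
      rw [hm, List.append_assoc, List.singleton_append, HV.prevOf_append_pair]
      intro e
      rw [hy] at e
      exact hch (Face.hv_eq_hv_iff.1 e.symm).1
  refine ⟨hmw, ?_, ?_⟩
  · unfold clsLoop
    rw [Finset.mem_filter]
    refine ⟨HV.mem_midWalks_iff.2 hmw, ?_, ?_⟩
    · rw [hwalk, List.cons_append, HV.finalDart_cons_append (by simp)]
    · rw [hwalk, List.cons_append]
      have : HV.inner (HV.wOut :: ((ω.2.hvInner ++ [f.hv ω.1]) ++ [f.hv ω.2.firstSideG])) =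
          ω.2.hvInner ++ [f.hv ω.1] := by
        simp [HV.inner]
      rw [this, List.mem_append]
      left
      rw [YBWalk.hvInner, mem_hvUpTo_iff]
      refine ⟨ω.2.firstHitG, hfh, ?_⟩
      unfold YBWalk.arcHV
      rw [hfc, hsIn, hz1, if_pos htri, List.mem_singleton]
  · obtain ⟨l₁, l₂, hvl, hl₂, he, -⟩ := exists_hvWalk_append_eq_lw_of_corner (hr := hr) hD' h hc
    have hc' : HV.IsCyc (f.hv ω.2.firstSideG :: l₂) := HV.lw_isCyc hwV (he ▸ hmw) hl₂
    have hpar := loopWnd_hvWalk_append_eq_rayCountAt_mod_two (hr := hr) hD' h hc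
    rw [he, HV.loopWnd_lw hvl] at hpar ⊢
    rw [hc'.wnd_ne_zero_iff_odd, ← ZMod.intCast_eq_one_iff_odd, hpar, ZMod.natCast_eq_one_iff_odd,
      AJ_root_ne_zero_iff_odd_rayCountAt (hr := hr) h (b := ((0 : ℤ), (0 : ℤ))) (τ := .W) rfl]

/-- ★★★ **THE CONVERSE FOR DIAGONAL-ENDING WALKS: EVERY LOOP-CLASS HONEYCOMB WALK AT A TRIANGLE `T` OF `f` WHOSE FINAL HALF-EDGE
RUNS ALONG THE SHORT DIAGONAL (from the other triangle `T'` towards `T`) IS THE PUSHED HONEYCOMB WALK OF A `θ`-CORNER RETURNING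
WALK**, of class `B2a` at `f` with its corner arc in `T`, of non-zero `π/3`-weight — and it encircles the root face iff that walk is
wound. (With edition 2: EVERY encircling loop-class walk at the two triangles of `f` — ending across a rhombus side or along the
diagonal — is accounted for by exactly one wound returning walk of non-zero weight: the non-`θ`-corner ones end across a side of
their return triangle, the `θ`-corner ones along the diagonal into their arc's triangle.)
[cite: GlazmanManolescu2019, §1 (θ = π/3; Fig. 2), Lemma 2.1] [cite: DuminilCopinSmirnov2012, proof of Lemma 1]
[cite: Glazman2015WeightedSAW, Lemma 3.1 (proof, pp. 6–7)] -/
theorem exists_isB2a_corner_of_mem_clsLoop_diag {Dl : List Face} {f : Face} (hD : ((-1 : ℤ), (0 : ℤ)) ∉ Dl)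
    {σ σ' : Side} (hσ : σ'.tri ≠ σ.tri) {P : List HV} (hP : P ∈ clsLoop (triSet Dl.toFinset) (f.hv σ))
    (hfst : (HV.finalDart P).1 = f.hv σ') :
    ∃ (ω : ΩG (PlaquetteWalk.dom Dl) origin f) (hr : RootedFace (PlaquetteWalk.dom Dl) origin f) (h : ω.IsB2a),
      ω.2.hvWalk ++ [f.hv σ] = P ∧ (ω.1).tri = σ'.tri ∧ ω.2.weight (fun _ => π / 3) ≠ 0 ∧
      arcKind ω.2.firstSideG (ω.z1 hr h) = .corner ∧ f.hv ω.2.firstSideG = f.hv σ ∧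
      (HV.loopWnd (f.hv σ) P ≠ 0 ↔ ω.AJ hr h (toC (midPt origin)) ≠ 0) := by
  have hD' : ((-1 : ℤ), (0 : ℤ)) ∉ PlaquetteWalk.dom Dl := hD
  have hDF : ((-1 : ℤ), (0 : ℤ)) ∉ Dl.toFinset := fun e => hD (List.mem_toFinset.1 e)
  have hwV : HV.wOut ∉ triSet Dl.toFinset := wOut_not_mem_triSet hDF
  have hDFi : ∀ g, g ∈ PlaquetteWalk.dom Dl ↔ g ∈ Dl.toFinset := fun g => by rw [List.mem_toFinset]; rfl
  rw [HV.clsLoop, Finset.mem_filter] at hP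
  obtain ⟨hPm, hlast, hinner⟩ := hP
  have hPw := HV.mem_midWalks_iff.1 hPm
  -- shape `P = w :: (l' ++ [x]) ++ [u]` with `u = T`, `x = T'`
  obtain ⟨Q, hQ⟩ := hPw.exists_eq_cons
  obtain ⟨l, u, hlu⟩ : ∃ l u, hvOrigin :: Q = l ++ [u] := by
    rcases (hvOrigin :: Q).eq_nil_or_concat' with h0 | ⟨l, u, h0⟩
    · simp at h0
    · exact ⟨l, u, h0⟩
  rw [hlu] at hQ
  have hl0 : l ≠ [] := by
    rintro rfl
    rw [hQ] at hinner
    simp [HV.inner] at hinner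
  obtain ⟨l', x, hlx⟩ : ∃ l' x, l = l' ++ [x] := by
    rcases l.eq_nil_or_concat' with h0 | ⟨l', x, h0⟩
    · exact absurd h0 hl0
    · exact ⟨l', x, h0⟩
  subst hlx
  have hu : u = f.hv σ := by
    have e := hlast
    rw [hQ, HV.finalDart_cons_append (by simp)] at e
    exact e
  have hx : x = f.hv σ' := by
    have e := hfst
    rw [hQ, HV.finalDart_cons_append (by simp)] at e
    simpa using e
  subst hu hx
  -- the prefix `w :: (l' ++ [T'])` is a mid-edge walk ending across a rhombus side of `T'`
  have hPw' : HV.IsMidWalk (triSet Dl.toFinset) (HV.wOut :: ((l' ++ [f.hv σ']) ++ [f.hv σ])) := by rw [← hQ]; exact hPw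
  have hQw : HV.IsMidWalk (triSet Dl.toFinset) (HV.wOut :: (l' ++ [f.hv σ'])) := HVAux.isMidWalk_prefix hwV hPw'
  -- bookkeeping of the list `P`
  have hP1 : (HV.wOut :: ((l' ++ [f.hv σ']) ++ [f.hv σ])).dropLast.dropLast = HV.wOut :: l' := by
    rw [show HV.wOut :: ((l' ++ [f.hv σ']) ++ [f.hv σ]) = ((HV.wOut :: l') ++ [f.hv σ']) ++ [f.hv σ] by simp,
      List.dropLast_concat, List.dropLast_concat]
  have hinner' : HV.inner (HV.wOut :: ((l' ++ [f.hv σ']) ++ [f.hv σ])) = l' ++ [f.hv σ'] := by simp [HV.inner]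
  rw [hQ, hinner'] at hinner
  have hndP : (l' ++ [f.hv σ']).Nodup := by
    have := hPw'.2.2.2.2.1; rwa [hinner'] at this
  have hxl : f.hv σ' ∉ l' := by
    intro hm
    exact (List.nodup_append.1 hndP).2.2 _ hm _ (List.mem_singleton_self _) rfl
  have hTl : f.hv σ ∈ l' := by
    rw [List.mem_append, List.mem_singleton] at hinner
    rcases hinner with hm | e
    · exact hm
    · exact absurd ((Face.hv_eq_hv_iff.1 e).2) (Ne.symm hσ)
  -- the vertex before `T'`: adjacent to `T'`, not `T` (no retracing), hence across a side `t` of `T'`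
  have hP2 : (HV.wOut :: ((l' ++ [f.hv σ']) ++ [f.hv σ])).getLast? = some (f.hv σ) := by
    rw [show HV.wOut :: ((l' ++ [f.hv σ']) ++ [f.hv σ]) = ((HV.wOut :: l') ++ [f.hv σ']) ++ [f.hv σ] by simp,
      List.getLast?_append, List.getLast?_singleton, Option.some_or]
  have hnr : (HV.wOut :: l').getLast (List.cons_ne_nil _ _) ≠ f.hv σ := by
    intro e
    apply hPw'.2.2.2.2.2
    rw [hP1, hP2, List.getLast?_eq_some_getLast (List.cons_ne_nil _ _), e]
  have hadj : hvGraph.Adj ((HV.wOut :: l').getLast (List.cons_ne_nil _ _)) (f.hv σ') := by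
    have hc := hQw.1
    rw [show HV.wOut :: (l' ++ [f.hv σ']) = (HV.wOut :: l') ++ [f.hv σ'] by simp, List.isChain_append] at hc
    exact hc.2.2 _ (by rw [Option.mem_def, List.getLast?_eq_some_getLast (List.cons_ne_nil _ _)]) _ (by simp)
  obtain ⟨t, httri, hy⟩ : ∃ t : Side, t.tri = σ'.tri ∧ (HV.wOut :: l').getLast (List.cons_ne_nil _ _) = f.hvAcross t := by
    rcases adj_hv_cases hadj.symm with ⟨τ', hτ', e⟩ | ⟨t, ht, e⟩
    · exfalso
      apply hnr
      rw [e]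
      refine Face.hv_eq_hv_iff.2 ⟨rfl, ?_⟩
      revert hτ' hσ; cases τ'.tri <;> cases σ'.tri <;> cases σ.tri <;> simp
    · exact ⟨t, ht, e⟩
  have hxt : f.hv σ' = f.hv t := Face.hv_eq_hv_iff.2 ⟨rfl, httri.symm⟩
  -- pull the prefix back to a Yang–Baxter walk
  have hfdQ : HV.finalDart (HV.wOut :: (l' ++ [f.hv σ'])) = (f.hvAcross t, f.hv t) := by
    rw [HVAux.finalDart_cons_append', hy, hxt]
  have hE : (edgeOf (HV.finalDart (HV.wOut :: (l' ++ [f.hv σ']))).1 (HV.finalDart (HV.wOut :: (l' ++ [f.hv σ']))).2).isSome := by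
    rw [hfdQ, edgeOf_hvAcross_hv]; rfl
  obtain ⟨z, γ, hγ⟩ := YBWalk.exists_hvWalk_eq (PlaquetteWalk.dom Dl) Dl.toFinset hDFi hD' _ _ rfl hQw hE
  have hn : 0 < γ.arcs.length := by
    by_contra h0
    rw [γ.hvWalk_of_origin_trivial hD' (by omega)] at hγ
    have hl' : l' = [] := by
      have hlen := congrArg List.length (List.cons.inj hγ).2
      simp only [List.length_cons, List.length_append, List.length_nil] at hlen
      exact List.eq_nil_of_length_eq_zero (by omega)
    rw [hl'] at hTl
    simp at hTl
  have hz : z = f.side t := by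
    have e := γ.edgeOf_finalDart_hvWalk_of_origin hD' hn
    rw [hγ, hfdQ, edgeOf_hvAcross_hv, Option.some.injEq] at e
    exact e.symm
  subst hz
  have hinQ : γ.hvInner = l' := by
    have e := γ.inner_hvWalk_of_origin hD'
    rw [hγ] at e
    simpa [HV.inner] using e.symm
  have hw : γ.weight (fun _ => π / 3) ≠ 0 := by
    rw [YBWalk.weight_pi_div_three_ne_zero_iff_nodup, hinQ]
    exact (List.nodup_append.1 hndP).1
  have hout : γ.acrossOut (γ.arcs.length - 1) = f.hv σ' := by
    have e := γ.hvWalk_of_origin hD' hn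
    rw [hγ, hinQ] at e
    have := List.append_cancel_left (List.cons.inj e).2.symm
    simpa using this
  have hch : γ.fc (γ.arcs.length - 1) ≠ f := by
    intro e
    have h1 : (γ.fc (γ.arcs.length - 1)).hvAcross (γ.sOut (γ.arcs.length - 1)) = f.hv σ' := hout
    rw [e] at h1
    exact Face.hvAcross_ne_hv f _ _ h1
  -- the arc in `f`: a corner arc in `T`, and the only arc in `f`
  rw [← hinQ, YBWalk.hvInner, mem_hvUpTo_iff] at hTl
  obtain ⟨k, hk, hkmem⟩ := hTl
  have hfk : γ.fc k = f := by
    rcases (mem_arcHV_iff (γ := γ)).1 hkmem with e | e <;> exact ((Face.hv_eq_hv_iff.1 e).1).symm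
  have hxin : f.hv σ' ∉ γ.hvInner := by rw [hinQ]; exact hxl
  have hcorner : (γ.sIn k).tri = (γ.sOut k).tri ∧ (γ.sIn k).tri = σ.tri := by
    have hm := hkmem
    unfold YBWalk.arcHV at hm
    split_ifs at hm with heq
    · rw [List.mem_singleton, hfk] at hm
      exact ⟨heq, ((Face.hv_eq_hv_iff.1 hm).2).symm⟩
    · exfalso
      apply hxin
      rw [YBWalk.hvInner, mem_hvUpTo_iff]
      refine ⟨k, hk, ?_⟩
      unfold YBWalk.arcHV
      rw [if_neg heq, hfk]
      rw [hfk] at hm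
      simp only [List.mem_cons, List.not_mem_nil, or_false] at hm ⊢
      rcases hm with e | e
      · right
        refine Face.hv_eq_hv_iff.2 ⟨rfl, ?_⟩
        have h2 := (Face.hv_eq_hv_iff.1 e).2
        revert heq h2 hσ; cases (γ.sIn k).tri <;> cases (γ.sOut k).tri <;> cases σ.tri <;> cases σ'.tri <;> simp
      · left
        refine Face.hv_eq_hv_iff.2 ⟨rfl, ?_⟩
        have h2 := (Face.hv_eq_hv_iff.1 e).2
        revert heq h2 hσ; cases (γ.sIn k).tri <;> cases (γ.sOut k).tri <;> cases σ.tri <;> cases σ'.tri <;> simp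
  have honly : ∀ j, j < γ.arcs.length → γ.fc j = f → j = k := by
    intro j hj hfj
    by_contra hne
    rcases Nat.lt_or_gt_of_ne hne with hlt | hgt
    · exact YBWalk.not_two_arcs_of_last_ne γ hch hlt hk hfj hfk
    · exact YBWalk.not_two_arcs_of_last_ne γ hch hgt hj hfk hfj
  -- the returning walk
  set ω : ΩG (PlaquetteWalk.dom Dl) origin f := ⟨t, γ⟩ with hω
  have hr : RootedFace (PlaquetteWalk.dom Dl) origin f :=
    ⟨by rw [← hfk]; exact (arcFace_arcAt hk).2, fun hh => hD' (by simpa [origin, MidEdge.faces] using hh.1)⟩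
  have hmemk : k ∈ γ.hitIdx f := (mem_hitIdx_of_arcFace hk (by rw [γ.arcFace_nth_eq_fc hk, hfk])).1
  have hFk : γ.firstHitG ≤ k := firstHit_le_of_memG γ hmemk
  have hF : γ.firstHitG < γ.arcs.length := by omega
  have hfcF : γ.fc γ.firstHitG = f := by
    have h1 := arcFace_firstHitG γ hr hF
    rw [γ.arcFace_nth_eq_fc hF, Option.some.injEq] at h1
    exact h1
  have hFeq : γ.firstHitG = k := honly _ hF hfcF
  have hkn : k + 1 < γ.arcs.length := by
    rcases Nat.lt_or_ge (k + 1) γ.arcs.length with h1 | h1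
    · exact h1
    · exact absurd (by rw [show γ.arcs.length - 1 = k by omega, hfk]) hch
  have h : ω.IsB2a := isB2a_of_forall_fc_ne (by rw [show ω.2 = γ from rfl]; omega) fun j hj1 hj2 hfj => by
    have := honly j hj2 hfj; rw [show ω.2 = γ from rfl] at hj1; omega
  obtain ⟨hfc', hsIn', hsOut'⟩ := fc_fh ω hr h
  have hside : ω.2.firstSideG = γ.sIn k := by rw [← hsIn', show ω.2 = γ from rfl, hFeq]
  have hz1 : ω.z1 hr h = γ.sOut k := by
    rw [← show ω.2.sOut ω.2.firstHitG = ω.z1 hr h from hsOut', show ω.2 = γ from rfl, hFeq]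
  have hTσ : f.hv ω.2.firstSideG = f.hv σ := by rw [hside]; exact Face.hv_eq_hv_iff.2 ⟨rfl, hcorner.2⟩
  have hst : ω.2.firstSideG ≠ ω.z1 hr h := by
    rw [hside, hz1]; exact (YBWalk.side_sIn hk).2.2
  have hc : arcKind ω.2.firstSideG (ω.z1 hr h) = .corner := by
    rw [arcKind_eq_corner_iff hst, hside, hz1]; exact hcorner.1
  have hPeq : ω.2.hvWalk ++ [f.hv σ] = P := by
    rw [show ω.2 = γ from rfl, hγ, hQ]; simp
  obtain ⟨-, -, hiff⟩ := hvWalk_append_mem_clsLoop_of_corner (hr := hr) hD h hc hw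
  rw [hTσ, hPeq] at hiff
  exact ⟨ω, hr, h, hPeq, httri, hw, hc, hTσ, hiff⟩

end ΩG

end CornerWalks

end YangBaxter

end Literature.Probability.RandomPlanarGeometry.SAW
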